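import Literature.Computability.FineGrained.OVFromSETHBuild
import Mathlib.Data.Nat.Size
import HarnessLib

/-!
# SETH ⇒ OV (fine-grained.S09): the OV-instance builder, II — parsing the sparsifier's output

Third part of the word-RAM program behind `ovConjectureDet_of_sethWordRAM` (R. Williams,
TCS 348 (2005), §5.1, Thm. 5.1; VVW ICM 2018, Thm. 3.1). After the simulated sparsifier has left the
string `KCNF.encodeList (F φ)` (Wave0's encoding: per formula the binary digits of `numVars`, a
comma, the clauses — bracket, literals as polarity bit + binary digits + comma, bracket — and a
terminating blank) on its output stack, the parser walks that stack from the top and, grammar-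
directed, updates the OV region of `OVFromSETHBuild.lean` so that it always holds the intended
memory `bheap` of the part read so far:

* the grammar of the tape (`OVRed.sBits`, `sLit`, `sClause`, `sFormula`, `sAll`) and the reading
  primitives (`advOps`, `isBitOps`, `OVRed.BP.bitsLoop` with `bitsLoop_spec`: a maximal run of digit
  symbols is consumed and its value accumulated, least significant digit first);
* the region lemmas: the generic `strideSet` / `strideAnd` of a row block are exactly the list
  surgeries of `OVFromSETHInstance.lean` on `bheap` (`bheap_exClear`, `bheap_clauseStartA/B`,
  `bheap_scatterA/B`);
* the routines `litP` (one literal: polarity, digits, comma, scatter on the proper side), `clauseP`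
  (bracket, the two clause-start fills, the literal loop, bracket), `formulaP` (guard clear, skip the
  digits of `numVars`, comma, clause loop, blank), `parsePhase` (pointer initialisation and the
  formula loop), with their certificates, culminating in **`OVRed.BP.parsePhase_spec`**: from
  `bheap g [] []` the parser reaches `bheap g F F` for the list `F` of clause lists on the tape,
  within `OVRed.BP.Tparse` steps (linear in the tape length times `H`).

[folklore] engineering (Nipkow–Klein, *Concrete Semantics*, §12).
-/

namespace Literature.Computability.FineGrained.OVRed

open Cryptography Cryptography.WordRAM Cryptography.WordRAM.SProg _root_.Computability Complexity

/-! ### The grammar of the tape -/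

/-- The binary digits of `v`, least significant first, as tape symbols. [folklore] -/
def sBits (v : ℕ) : List Γ' := v.bits.map Γ'.bit

/-- A literal on the tape: polarity, digits of the variable, comma. [folklore] -/
def sLit (l : Literal ℕ) : List Γ' := Γ'.bit l.2 :: (sBits l.1 ++ [Γ'.comma])

/-- A clause on the tape: its literals between brackets. [folklore] -/
def sClause (C : Clause ℕ) : List Γ' := Γ'.bra :: (C.flatMap sLit ++ [Γ'.ket])

/-- A formula on the tape: digits of its variable number, comma, clauses. [folklore] -/
def sFormula (f : ℕ × CNF ℕ) : List Γ' := sBits f.1 ++ Γ'.comma :: f.2.flatMap sClause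

/-- A list of formulas on the tape, each terminated by a blank. [folklore] -/
def sAll (Fs : List (ℕ × CNF ℕ)) : List Γ' := Fs.flatMap fun f => sFormula f ++ [Γ'.blank]

/-- Is the symbol a digit? [folklore] -/
def isBitSym : Γ' → Bool
  | .bit _ => true
  | _ => false

/-- The value of a digit list, least significant digit first, below position `k`. [folklore] -/
def pv (bs : List Bool) : ℕ → ℕ
  | 0 => 0
  | k + 1 => pv bs k + (bs.getD k false).toNat * 2 ^ k

/-- The digits of `v` have value `v`: prefix sums are `v % 2^k`. [folklore] -/
theorem pv_bits (v : ℕ) : ∀ k, pv v.bits k = v % 2 ^ k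
  | 0 => by simp [pv, Nat.mod_one]
  | k + 1 => by
    rw [pv, pv_bits v k, Nat.mod_pow_succ]
    have h1 : (v.bits.getD k false) = v.testBit k := by
      rw [Nat.testBit_eq_inth]; rfl
    rw [h1, Nat.toNat_testBit]
    ring

/-- All digits of `v` have value `v`. [folklore] -/
theorem pv_bits_length (v : ℕ) : pv v.bits v.bits.length = v := by
  rw [pv_bits, Nat.size_eq_bits_len, Nat.mod_eq_of_lt (Nat.lt_size_self v)]

/-- Prefix values are bounded by `2^k`. [folklore] -/
theorem pv_lt (bs : List Bool) : ∀ k, pv bs k < 2 ^ k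
  | 0 => by simp [pv]
  | k + 1 => by
    rw [pv, Nat.pow_succ]
    have := pv_lt bs k
    have : (bs.getD k false).toNat ≤ 1 := Bool.toNat_le _
    nlinarith

/-- `2 ^ size v ≤ 2 v + 1`. [folklore] -/
theorem two_pow_size_le (v : ℕ) : 2 ^ Nat.size v ≤ 2 * v + 1 := by
  rcases Nat.eq_zero_or_pos v with rfl | hv
  · simp
  · have h := Nat.size_pos.2 hv
    have : 2 ^ (Nat.size v - 1) ≤ v := by
      by_contra hlt
      have := Nat.size_le.2 (Nat.not_le.1 hlt)
      omega
    calc 2 ^ Nat.size v = 2 * 2 ^ (Nat.size v - 1) := by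
          rw [← Nat.pow_succ']; congr 1; omega
      _ ≤ 2 * v + 1 := by omega

namespace BP

variable (g : BP) {W : ℕ}

/-! ### Reading the tape -/

/-- Is position `s` of the tape a digit? [folklore] -/
def isBitAt (s : ℕ) : Bool := match g.str[s]? with
  | some γ => isBitSym γ
  | none => false

/-- The pointer and symbol registers are at position `s`. [folklore] -/
def At (m : ℕ → ℕ) (s : ℕ) : Prop := m 40 = g.addr s ∧ m 41 = g.tape s

/-- Advance to the next symbol: `r40 -= κ; r41 := mem[r40]`. [folklore] -/
def advOps : List OpSpec := [(.sub, r 40, r 40, im g.κ), (.band, r 41, pt 40, pt 40)]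

/-- The digit test: `r49 := [r41 = code (bit 0)] + [r41 = code (bit 1)]`. [folklore] -/
def isBitOps : List OpSpec :=
  [(.eq, r 49, r 41, im (g.cd (Γ'.bit false))), (.eq, r 52, r 41, im (g.cd (Γ'.bit true))),
    (.add, r 49, r 49, r 52)]

/-- The tape one position further. [folklore] -/
theorem addr_succ {s : ℕ} (hs : s < g.len) : g.addr s - g.κ = g.addr (s + 1) ∧ g.κ ≤ g.addr s := by
  unfold addr
  have : g.len - s = (g.len - (s + 1)) + 1 := by omega
  rw [this, Nat.mul_succ]
  omega

/-- Tape addresses are above the region and below `2 ^ W`. [folklore] -/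
theorem addr_bounds (hK : g.OK W) (s : ℕ) : g.rEnd ≤ g.addr s ∧ 100 ≤ g.addr s ∧ g.addr s < 2 ^ W := by
  obtain ⟨hBv, hA, hB, hE, hNd, -, -, -, hQ, hbot, htop, -⟩ := g.facts hK
  unfold addr
  have : g.κ * (g.len - s) ≤ g.κ * g.len := Nat.mul_le_mul_left _ (Nat.sub_le _ _)
  omega

/-- The tape value at a digit / non-digit position, compared with the two digit codes. [folklore] -/
theorem tape_eq_code_iff (hK : g.OK W) (s : ℕ) (γ : Γ') : g.tape s = g.cd γ ↔ g.str[s]? = some γ := by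
  unfold tape
  by_cases hs : s < g.len
  · rw [dif_pos hs, List.getElem?_eq_getElem hs, Option.some.injEq]
    exact ⟨fun h => (hK.cd_inj s hs γ h.symm).symm, fun h => by rw [h]⟩
  · rw [dif_neg hs, List.getElem?_eq_none_iff.2 (Nat.not_lt.1 hs)]
    simp only [reduceCtorEq, iff_false]
    exact fun h => (hK.cd_pos γ).ne h

/-- The digit test in closed form. [folklore] -/
theorem isBit_val (hK : g.OK W) (s : ℕ) :
    (if g.tape s = g.cd (Γ'.bit false) then 1 else 0) + (if g.tape s = g.cd (Γ'.bit true) then 1 else 0)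
      = (g.isBitAt s).toNat := by
  simp only [g.tape_eq_code_iff hK]
  unfold isBitAt
  cases hγ : g.str[s]? with
  | none => simp
  | some γ =>
    cases γ with
    | bit b => cases b <;> simp [isBitSym]
    | _ => simp [isBitSym]

/-- A tape position is a digit iff the string has a digit there. [folklore] -/
theorem isBitAt_of_prefix (pre : List Γ') (b : Bool) (rest : List Γ') (h : g.str = pre ++ Γ'.bit b :: rest) :
    g.isBitAt pre.length = true := by
  unfold isBitAt; rw [h, List.getElem?_append_right le_rfl, Nat.sub_self]; rfl

/-- The tape symbol at the start of a known suffix. [folklore] -/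
theorem str_getElem?_prefix (pre : List Γ') (γ : Γ') (rest : List Γ') (h : g.str = pre ++ γ :: rest) :
    g.str[pre.length]? = some γ := by
  rw [h, List.getElem?_append_right le_rfl, Nat.sub_self]; rfl

/-- The tape value at the start of a known suffix. [folklore] -/
theorem tape_prefix (pre : List Γ') (γ : Γ') (rest : List Γ') (h : g.str = pre ++ γ :: rest) :
    g.tape pre.length = g.cd γ := by
  have hs : pre.length < g.len := by unfold len; rw [h]; simp
  unfold tape; rw [dif_pos hs]
  congr 1
  have := g.str_getElem?_prefix pre γ rest h
  rw [List.getElem?_eq_getElem hs, Option.some.injEq] at this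
  exact this

/-- A position at the end of the string or before a non-digit is not a digit. [folklore] -/
theorem isBitAt_false_of_prefix (pre rest : List Γ') (h : g.str = pre ++ rest)
    (hrest : ∀ b rest', rest ≠ Γ'.bit b :: rest') : g.isBitAt pre.length = false := by
  unfold isBitAt
  rw [h, List.getElem?_append_right le_rfl, Nat.sub_self]
  cases rest with
  | nil => rfl
  | cons γ rest' =>
    cases γ with
    | bit b => exact absurd rfl (hrest b rest')
    | _ => rfl

section specs

variable {O : List ℕ → List ℕ}

/-- **Advancing** (symbolic execution of `advOps` on a split memory): from position `s < len`
to position `s + 1`, given that the data agrees with the tape there. [folklore] -/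
theorem execOps_advOps (hK : g.OK W) {R Hp : ℕ → ℕ} {s : ℕ} (hs : s < g.len) (h40 : R 40 = g.addr s)
    (htp : Hp (g.addr (s + 1)) = g.tape (s + 1)) :
    execOps W (merge R Hp) g.advOps =
      merge (Function.update (Function.update R 40 (g.addr (s + 1))) 41 (g.tape (s + 1))) Hp := by
  obtain ⟨hsub, hκ⟩ := g.addr_succ hs
  obtain ⟨hr1, h100, hW1⟩ := g.addr_bounds hK (s + 1)
  obtain ⟨-, -, hW0⟩ := g.addr_bounds hK s
  unfold advOps
  simp (disch := omega) only [execOps_cons, execOps_nil, execOp, Operand.write, Operand.read,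
    merge_apply_of_lt, update_merge_of_lt, Function.update_self, h40]
  rw [BinOp.eval_sub_of_le hκ hW0, hsub]
  simp (disch := omega) only [merge_apply_of_le, BinOp.eval_band, Nat.and_self, htp]

/-- **The digit test** (symbolic execution of `isBitOps` on a split memory). [folklore] -/
theorem execOps_isBitOps (hK : g.OK W) {R : ℕ → ℕ} (Hp : ℕ → ℕ) {s : ℕ} (h41 : R 41 = g.tape s) :
    ∃ v52, execOps W (merge R Hp) g.isBitOps =
      merge (Function.update (Function.update (Function.update R 49
        (if g.tape s = g.cd (Γ'.bit false) then 1 else 0)) 52 v52) 49 (g.isBitAt s).toNat) Hp := by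
  refine ⟨if g.tape s = g.cd (Γ'.bit true) then 1 else 0, ?_⟩
  have h1 : (if g.tape s = g.cd (Γ'.bit false) then 1 else 0) +
      (if g.tape s = g.cd (Γ'.bit true) then 1 else 0) < 2 ^ W := by
    rw [g.isBit_val hK]; exact lt_of_le_of_lt (Bool.toNat_le _) (g.facts hK).2.2.2.2.2.2.2.2.2.2.2.2.2.1
  unfold isBitOps
  simp (disch := omega) only [execOps_cons, execOps_nil, execOp, Operand.write, Operand.read,
    merge_apply_of_lt, update_merge_of_lt, Function.update_self, Function.update_of_ne, h41,
    BinOp.eval_eq]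
  rw [BinOp.eval_add_of_lt h1, g.isBit_val hK]

/-! ### The digit loop -/

/-- **The digit loop**: while the symbol is a digit, accumulate it (`r47 += [digit = 1] · r48;
r48 *= 2`) and advance. [folklore] -/
def bitsLoop : SProg :=
  whilenz (r 49) (block ([(.eq, r 52, r 41, im (g.cd (Γ'.bit true))), (.mul, r 52, r 52, r 48),
    (.add, r 47, r 47, r 52), (.add, r 48, r 48, r 48)] ++ g.advOps ++ g.isBitOps))

/-- The invariant of the digit loop over the digits `bs` read from position `s₀` with initial
accumulator `acc₀` and weight `pow₀`. [folklore] -/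
def BitsInv (m₀ : ℕ → ℕ) (s₀ acc₀ pow₀ : ℕ) (bs : List Bool) (k : ℕ) (m : ℕ → ℕ) : Prop :=
  g.At m (s₀ + k) ∧ m 49 = (g.isBitAt (s₀ + k)).toNat ∧ m 47 = acc₀ + pow₀ * pv bs k ∧
    m 48 = pow₀ * 2 ^ k ∧ (∀ i, i < 100 → i ≠ 40 → i ≠ 41 → i ≠ 47 → i ≠ 48 → i ≠ 49 → i ≠ 52 →
      m i = m₀ i) ∧ ∀ a, 100 ≤ a → m a = m₀ a

set_option linter.unusedSimpArgs false in
/-- **Semantics of the digit loop.** If the tape from position `s₀` reads the digits `bs` followed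
by no digit, then from `At s₀` with the digit flag in `r49`, accumulator `acc₀` and weight `pow₀`
(`acc₀ + pow₀ · 2^{|bs|} < 2^W`), the loop ends at position `s₀ + |bs|` with `r49 = 0`,
`r47 = acc₀ + pow₀ · (value of bs)`, `r48 = pow₀ · 2^{|bs|}`, changing only `r40, r41, r47, r48,
r49, r52`, within `11 |bs| + 1` steps. [folklore] -/
theorem bitsLoop_spec (hK : g.OK W) {m₀ : ℕ → ℕ} {pre : List Γ'} {bs : List Bool} {rest : List Γ'}
    (hstr : g.str = pre ++ bs.map Γ'.bit ++ rest) (hrest : ∀ b rest', rest ≠ Γ'.bit b :: rest')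
    {acc₀ pow₀ : ℕ} (hB : acc₀ + pow₀ * 2 ^ bs.length < 2 ^ W)
    (htape : ∀ s, s ≤ g.len → m₀ (g.addr s) = g.tape s) (hI : g.BitsInv m₀ pre.length acc₀ pow₀ bs 0 m₀) :
    Achieves W O g.bitsLoop m₀ (g.BitsInv m₀ pre.length acc₀ pow₀ bs bs.length) (bs.length * (9 + 2) + 1) := by
  have h1W : 1 < 2 ^ W := (g.facts hK).2.2.2.2.2.2.2.2.2.2.2.2.2.1
  have hlen : pre.length + bs.length ≤ g.len := by unfold len; rw [hstr]; simp
  -- the digit positions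
  have hdig : ∀ k (hk : k < bs.length), g.str = (pre ++ (bs.take k).map Γ'.bit) ++
      Γ'.bit (bs[k]'(by omega)) :: ((bs.drop (k + 1)).map Γ'.bit ++ rest) := by
    intro k hk
    have hbs : bs = bs.take k ++ bs[k] :: bs.drop (k + 1) := by
      conv_lhs => rw [← List.take_append_drop k bs, List.drop_eq_getElem_cons hk]
    have hmap : bs.map Γ'.bit = (bs.take k).map Γ'.bit ++ Γ'.bit (bs[k]) :: (bs.drop (k + 1)).map Γ'.bit := by
      conv_lhs => rw [hbs]
      rw [List.map_append, List.map_cons]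
    rw [hstr, hmap]; simp only [List.append_assoc, List.cons_append]
  have hend : g.str = (pre ++ bs.map Γ'.bit) ++ rest := by rw [hstr]
  refine Achieves.whilenz bs.length 9 (g.BitsInv m₀ pre.length acc₀ pow₀ bs)
    (fun k hk m hI' => ⟨?_, ?_⟩) (fun m hI' => ?_) hI (fun m h => h) le_rfl
  · -- the test reads nonzero: position `s₀ + k` is a digit
    obtain ⟨-, h49, -⟩ := hI'
    have := g.isBitAt_of_prefix _ _ _ (hdig k hk)
    simp only [List.length_append, List.length_map, List.length_take, Nat.min_eq_left hk.le] at this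
    simp only [Operand.read, h49, this]; decide
  · -- the body
    obtain ⟨⟨h40, h41⟩, h49, h47, h48, hfr, hD⟩ := hI'
    have hsk : pre.length + k < g.len := by omega
    have hsym : g.tape (pre.length + k) = g.cd (Γ'.bit (bs[k]'(by omega))) := by
      have := g.tape_prefix _ _ _ (hdig k hk)
      simpa [Nat.min_eq_left hk.le] using this
    have hdval : (if g.tape (pre.length + k) = g.cd (Γ'.bit true) then 1 else 0) =
        (bs[k]'(by omega)).toNat := by
      simp only [g.tape_eq_code_iff hK]
      have := g.str_getElem?_prefix _ _ _ (hdig k hk)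
      simp only [List.length_append, List.length_map, List.length_take, Nat.min_eq_left hk.le] at this
      simp only [this]; cases bs[k] <;> simp
    have hgetD : bs.getD k false = bs[k]'(by omega) := List.getD_eq_getElem _ _ _
    -- bounds
    have hpk : pow₀ * 2 ^ (k + 1) ≤ pow₀ * 2 ^ bs.length :=
      Nat.mul_le_mul_left _ (Nat.pow_le_pow_right (by norm_num) hk)
    have hpv := pv_lt bs k
    have hpv' : pv bs (k + 1) < 2 ^ (k + 1) := pv_lt bs (k + 1)
    have hb1 : (bs[k]'(by omega)).toNat ≤ 1 := Bool.toNat_le _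
    have hacc : acc₀ + pow₀ * pv bs (k + 1) < 2 ^ W := by
      have : pow₀ * pv bs (k + 1) ≤ pow₀ * 2 ^ bs.length :=
        Nat.mul_le_mul_left _ (le_trans hpv'.le (Nat.pow_le_pow_right (by norm_num) hk))
      omega
    have hpvs : pv bs (k + 1) = pv bs k + (bs[k]'(by omega)).toNat * 2 ^ k := by rw [pv, hgetD]
    refine achieves_block_of_eq (fun m'' hm'' => ?_) (by simp only [advOps, isBitOps, List.length_cons, List.length_nil, List.length_append]; omega)
    rw [execOps_append, execOps_append] at hm''
    -- the four accumulation instructions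
    have hm1 : (bs[k]'(by omega)).toNat * (pow₀ * 2 ^ k) ≤ pow₀ * 2 ^ k := by
      calc _ ≤ 1 * (pow₀ * 2 ^ k) := Nat.mul_le_mul_right _ hb1
        _ = _ := Nat.one_mul _
    have hacc4 : execOps W (merge m m) [(.eq, r 52, r 41, im (g.cd (Γ'.bit true))),
        (.mul, r 52, r 52, r 48), (.add, r 47, r 47, r 52), (.add, r 48, r 48, r 48)] =
        merge (Function.update (Function.update (Function.update (Function.update m 52
          (bs[k]'(by omega)).toNat) 52 ((bs[k]'(by omega)).toNat * (pow₀ * 2 ^ k))) 47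
          (acc₀ + pow₀ * pv bs (k + 1))) 48 (pow₀ * 2 ^ (k + 1))) m := by
      have e1 : acc₀ + pow₀ * pv bs k + (bs[k]'(by omega)).toNat * (pow₀ * 2 ^ k) = acc₀ + pow₀ * pv bs (k + 1) := by
        rw [hpvs]; ring
      have e2 : pow₀ * 2 ^ k + pow₀ * 2 ^ k = pow₀ * 2 ^ (k + 1) := by rw [Nat.pow_succ]; ring
      have hlt1 : acc₀ + pow₀ * pv bs k + (bs[k]'(by omega)).toNat * (pow₀ * 2 ^ k) < 2 ^ W := by rw [e1]; exact hacc
      have hlt2 : pow₀ * 2 ^ k + pow₀ * 2 ^ k < 2 ^ W := by rw [e2]; omega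
      simp (disch := omega) only [execOps_cons, execOps_nil, execOp, Operand.write, Operand.read,
        merge_apply_of_lt, update_merge_of_lt, Function.update_self, Function.update_of_ne, h41, h47,
        h48, BinOp.eval_eq, hdval]
      rw [BinOp.eval_mul_of_lt (by omega), BinOp.eval_add_of_lt hlt1, BinOp.eval_add_of_lt hlt2, e1, e2]
    rw [hacc4] at hm''
    -- advancing and the digit test
    have htp₁ : m (g.addr (pre.length + k + 1)) = g.tape (pre.length + k + 1) := by
      obtain ⟨-, h100, -⟩ := g.addr_bounds hK (pre.length + k + 1)
      rw [hD _ h100, htape _ (by omega)]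
    rw [g.execOps_advOps hK hsk (by simp [h40]) htp₁] at hm''
    obtain ⟨v52, h52⟩ := g.execOps_isBitOps hK m (s := pre.length + k + 1)
      (R := Function.update (Function.update (Function.update (Function.update (Function.update
        (Function.update m 52 (bs[k]'(by omega)).toNat) 52 ((bs[k]'(by omega)).toNat * (pow₀ * 2 ^ k))) 47
        (acc₀ + pow₀ * pv bs (k + 1))) 48 (pow₀ * 2 ^ (k + 1))) 40 (g.addr (pre.length + k + 1))) 41
        (g.tape (pre.length + k + 1))) (by simp)
    rw [h52] at hm''
    subst hm''
    refine ⟨⟨?_, ?_⟩, ?_, ?_, ?_, fun i hi h40' h41' h47' h48' h49' h52' => ?_, fun a ha => ?_⟩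
    · simp (disch := omega) only [merge_apply_of_lt, Function.update_of_ne, Function.update_self,
        Nat.add_assoc]
    · simp (disch := omega) only [merge_apply_of_lt, Function.update_of_ne, Function.update_self,
        Nat.add_assoc]
    · simp (disch := omega) only [merge_apply_of_lt, Function.update_self, Nat.add_assoc]
    · simp (disch := omega) only [merge_apply_of_lt, Function.update_of_ne, Function.update_self]
    · simp (disch := omega) only [merge_apply_of_lt, Function.update_of_ne, Function.update_self]
    · rw [merge_apply_of_lt hi]
      simp (disch := omega) only [Function.update_of_ne]
      exact hfr i hi h40' h41' h47' h48' h49' h52'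
    · rw [merge_apply_of_le ha, hD a ha]
  · -- exit: no digit at position `s₀ + |bs|`
    obtain ⟨-, h49, -⟩ := hI'
    have := g.isBitAt_false_of_prefix _ _ hend hrest
    simp only [List.length_append, List.length_map] at this
    simp only [Operand.read, h49, this, Bool.toNat_false]

end specs

/-! ### Region lemmas: the generic loops are the list surgeries on the intended memory -/

section region

variable {g}

/-- The rows of formula `i`. [folklore] -/
theorem div_eq_iff_row {H i r : ℕ} (hH : 0 < H) : r / H = i ↔ i * H ≤ r ∧ r < i * H + H := by
  constructor
  · rintro rfl; exact ⟨Nat.div_mul_le_self r H, Nat.lt_div_mul_add hH⟩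
  · rintro ⟨h1, h2⟩; exact Nat.div_eq_of_lt_le h1 (by rw [Nat.succ_mul]; exact h2)

/-- In a row of formula `i`, the half-assignment is the offset. [folklore] -/
theorem mod_eq_sub_row {H i r : ℕ} (h : r / H = i) : r % H = r - i * H := by
  have := Nat.div_add_mod r H
  rw [h, Nat.mul_comm] at this; omega

/-- `bheap` does not depend on the formula lists outside the two sides. [folklore] -/
theorem bheap_indep (FA FB FA' FB' : List (CNF ℕ)) {a : ℕ} (ha : a < g.Abase ∨ g.rEnd ≤ a) :
    g.bheap FA FB a = g.bheap FA' FB' a := by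
  obtain ⟨hA, hB, hE, hNd, -, -, -, -⟩ := g.layout
  unfold bheap
  by_cases h0 : a = g.Bv; · simp [h0]
  by_cases h1 : a = g.Bv + 1; · simp [h1]
  by_cases h2 : a = g.Bv + 2; · simp [h2]
  rw [if_neg h0, if_neg h1, if_neg h2, if_neg h0, if_neg h1, if_neg h2, if_neg (by omega),
    if_neg (by omega), if_neg (by omega), if_neg (by omega)]

/-- **Region lemma (a): the guard clear of a new formula.** [folklore] -/
theorem bheap_exClear (hK : g.OK W) (L : List (CNF ℕ)) {i : ℕ} (hL : L.length = i)
    (hi : i * g.H + g.H ≤ g.N) : ∀ a, 100 ≤ a →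
    strideSet (g.bheap L L) (g.Abase + i * g.H * g.d + g.EX) g.d 0 g.H a = g.bheap (L ++ [[]]) (L ++ [[]]) a := by
  obtain ⟨hBv, hA, hB, hE, hNd, -, -, hEXe, -, -, -, hEX, hd, -, -, hdNd, -⟩ := g.facts hK
  have hH : 0 < g.H := by rw [hK.H_eq]; exact Nat.two_pow_pos _
  refine g.data_ext hd ⟨?_, ?_, ?_⟩ (fun r j hr hj => ?_) (fun r j hr hj => ?_) (fun a ha hout => ?_)
  · rw [strideSet_of_lt_base (by omega : g.Bv < g.Abase)]
    exact g.bheap_indep _ _ _ _ (Or.inl (by omega))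
  · rw [strideSet_of_lt_base (by omega : g.Bv + 1 < g.Abase)]
    exact g.bheap_indep _ _ _ _ (Or.inl (by omega))
  · rw [strideSet_of_lt_base (by omega : g.Bv + 2 < g.Abase)]
    exact g.bheap_indep _ _ _ _ (Or.inl (by omega))
  · rw [strideSet_rowAddr hEX hj, g.bheap_A _ _ hr hj, g.bheap_A _ _ hr hj, uCoord_append_nil, hL]
    by_cases hrow : r / g.H = i
    · have := (div_eq_iff_row hH).1 hrow
      by_cases hjx : j = g.EX
      · rw [if_pos ⟨hjx, this.1, this.2⟩, if_pos ⟨hrow, by omega⟩]; rfl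
      · rw [if_neg (fun h => hjx h.1), if_neg (fun h => hjx (by omega))]
    · rw [if_neg (fun h => hrow ((div_eq_iff_row hH).2 ⟨h.2.1, h.2.2⟩)), if_neg (fun h => hrow h.1)]
  · have hlt := rowAddr_lt (base₀ := g.Bbase) hr hj
    rw [strideSet_of_side_end_le (N := g.N) hEX hi (by omega : g.Abase + g.N * g.d ≤ g.Bbase + r * g.d + j),
      g.bheap_B _ _ hr hj, g.bheap_B _ _ hr hj, vCoord_append_nil]
  · rcases hout with hout | hout
    · rw [strideSet_of_lt_base (by omega : a < g.Abase)]
      exact g.bheap_indep _ _ _ _ (Or.inl (by omega))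
    · rw [strideSet_of_side_end_le (N := g.N) hEX hi (by omega : g.Abase + g.N * g.d ≤ a)]
      exact g.bheap_indep _ _ _ _ (Or.inr hout)

/-- **Region lemma (b), side `A`: the start of a clause.** [folklore] -/
theorem bheap_clauseStartA (hK : g.OK W) (G : List (CNF ℕ)) (ψ : CNF ℕ) (FB : List (CNF ℕ))
    {i j : ℕ} (hG : G.length = i) (hψ : ψ.length = j) (hjD : j < g.D) (hi : i * g.H + g.H ≤ g.N) :
    ∀ a, 100 ≤ a →
      strideSet (g.bheap (G ++ [ψ]) FB) (g.Abase + i * g.H * g.d + j) g.d 1 g.H a =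
        g.bheap (G ++ [ψ ++ [[]]]) FB a := by
  obtain ⟨hBv, hA, hB, hE, hNd, -, -, hEXe, -, -, -, hEX, hd, -, -, hdNd, -⟩ := g.facts hK
  have hH : 0 < g.H := by rw [hK.H_eq]; exact Nat.two_pow_pos _
  have hjd : j < g.d := by omega
  refine g.data_ext hd ⟨?_, ?_, ?_⟩ (fun r j' hr hj' => ?_) (fun r j' hr hj' => ?_) (fun a ha hout => ?_)
  · rw [strideSet_of_lt_base (by omega : g.Bv < g.Abase)]
    exact g.bheap_indep _ _ _ _ (Or.inl (by omega))
  · rw [strideSet_of_lt_base (by omega : g.Bv + 1 < g.Abase)]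
    exact g.bheap_indep _ _ _ _ (Or.inl (by omega))
  · rw [strideSet_of_lt_base (by omega : g.Bv + 2 < g.Abase)]
    exact g.bheap_indep _ _ _ _ (Or.inl (by omega))
  · rw [strideSet_rowAddr hjd hj', g.bheap_A _ _ hr hj', g.bheap_A _ _ hr hj',
      uCoord_snoc_nilClause _ _ _ _ _ _ _ _ (by omega), hG, hψ]
    by_cases hrow : r / g.H = i
    · have := (div_eq_iff_row hH).1 hrow
      by_cases hjx : j' = j
      · rw [if_pos ⟨hjx, this.1, this.2⟩, if_pos ⟨hrow, hjx⟩]; rfl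
      · rw [if_neg (fun h => hjx h.1), if_neg (fun h => hjx h.2)]
    · rw [if_neg (fun h => hrow ((div_eq_iff_row hH).2 ⟨h.2.1, h.2.2⟩)), if_neg (fun h => hrow h.1)]
  · have hlt := rowAddr_lt (base₀ := g.Bbase) hr hj'
    rw [strideSet_of_side_end_le (N := g.N) hjd hi (by omega : g.Abase + g.N * g.d ≤ g.Bbase + r * g.d + j'),
      g.bheap_B _ _ hr hj', g.bheap_B _ _ hr hj']
  · rcases hout with hout | hout
    · rw [strideSet_of_lt_base (by omega : a < g.Abase)]
      exact g.bheap_indep _ _ _ _ (Or.inl (by omega))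
    · rw [strideSet_of_side_end_le (N := g.N) hjd hi (by omega : g.Abase + g.N * g.d ≤ a)]
      exact g.bheap_indep _ _ _ _ (Or.inr hout)

/-- **Region lemma (b), side `B`.** [folklore] -/
theorem bheap_clauseStartB (hK : g.OK W) (FA G : List (CNF ℕ)) (ψ : CNF ℕ)
    {i j : ℕ} (hG : G.length = i) (hψ : ψ.length = j) (hjD : j < g.D) (hi : i * g.H + g.H ≤ g.N) :
    ∀ a, 100 ≤ a →
      strideSet (g.bheap FA (G ++ [ψ])) (g.Bbase + i * g.H * g.d + j) g.d 1 g.H a =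
        g.bheap FA (G ++ [ψ ++ [[]]]) a := by
  obtain ⟨hBv, hA, hB, hE, hNd, -, -, hEXe, -, -, -, hEX, hd, -, -, hdNd, -⟩ := g.facts hK
  have hH : 0 < g.H := by rw [hK.H_eq]; exact Nat.two_pow_pos _
  have hjd : j < g.d := by omega
  refine g.data_ext hd ⟨?_, ?_, ?_⟩ (fun r j' hr hj' => ?_) (fun r j' hr hj' => ?_) (fun a ha hout => ?_)
  · rw [strideSet_of_lt_base (by omega : g.Bv < g.Bbase)]
    exact g.bheap_indep _ _ _ _ (Or.inl (by omega))
  · rw [strideSet_of_lt_base (by omega : g.Bv + 1 < g.Bbase)]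
    exact g.bheap_indep _ _ _ _ (Or.inl (by omega))
  · rw [strideSet_of_lt_base (by omega : g.Bv + 2 < g.Bbase)]
    exact g.bheap_indep _ _ _ _ (Or.inl (by omega))
  · have hlt := rowAddr_lt (base₀ := g.Abase) hr hj'
    rw [strideSet_of_lt_base (by omega : g.Abase + r * g.d + j' < g.Bbase), g.bheap_A _ _ hr hj',
      g.bheap_A _ _ hr hj']
  · rw [strideSet_rowAddr hjd hj', g.bheap_B _ _ hr hj', g.bheap_B _ _ hr hj',
      vCoord_snoc_nilClause _ _ _ _ _ _ _ _ (by omega), hG, hψ]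
    by_cases hrow : r / g.H = i
    · have := (div_eq_iff_row hH).1 hrow
      by_cases hjx : j' = j
      · rw [if_pos ⟨hjx, this.1, this.2⟩, if_pos ⟨hrow, hjx⟩]; rfl
      · rw [if_neg (fun h => hjx h.1), if_neg (fun h => hjx h.2)]
    · rw [if_neg (fun h => hrow ((div_eq_iff_row hH).2 ⟨h.2.1, h.2.2⟩)), if_neg (fun h => hrow h.1)]
  · rcases hout with hout | hout
    · rw [strideSet_of_lt_base (by omega : a < g.Bbase)]
      exact g.bheap_indep _ _ _ _ (Or.inl (by omega))
    · rw [strideSet_of_side_end_le (N := g.N) hjd hi (by omega : g.Bbase + g.N * g.d ≤ a)]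
      exact g.bheap_indep _ _ _ _ (Or.inr hout)

/-- The scatter factor is the update of a clause coordinate by a literal. [folklore] -/
theorem toNat_and_scatter (u : Bool) (p pos : ℕ) (b : Bool) :
    (u && !(p.testBit pos == b)).toNat = u.toNat &&& scatterBit pos b p := by
  unfold scatterBit; cases u <;> cases p.testBit pos <;> cases b <;> rfl

/-- **Region lemma (c), side `A`: a first-half literal.** [folklore] -/
theorem bheap_scatterA (hK : g.OK W) (G : List (CNF ℕ)) (ψ : CNF ℕ) (C : Clause ℕ) (l : Literal ℕ)
    (FB : List (CNF ℕ)) {i j : ℕ} (hG : G.length = i) (hψ : ψ.length = j) (hjD : j < g.D)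
    (hi : i * g.H + g.H ≤ g.N) (hl : l.1 < g.hh) : ∀ a, 100 ≤ a →
      strideAnd (g.bheap (G ++ [ψ ++ [C]]) FB) (g.Abase + i * g.H * g.d + j) g.d l.1 l.2 g.H a =
        g.bheap (G ++ [ψ ++ [C ++ [l]]]) FB a := by
  obtain ⟨hBv, hA, hB, hE, hNd, -, -, hEXe, -, -, -, hEX, hd, -, -, hdNd, -⟩ := g.facts hK
  have hH : 0 < g.H := by rw [hK.H_eq]; exact Nat.two_pow_pos _
  have hjd : j < g.d := by omega
  refine g.data_ext hd ⟨?_, ?_, ?_⟩ (fun r j' hr hj' => ?_) (fun r j' hr hj' => ?_) (fun a ha hout => ?_)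
  · rw [strideAnd_of_lt_base (by omega : g.Bv < g.Abase)]
    exact g.bheap_indep _ _ _ _ (Or.inl (by omega))
  · rw [strideAnd_of_lt_base (by omega : g.Bv + 1 < g.Abase)]
    exact g.bheap_indep _ _ _ _ (Or.inl (by omega))
  · rw [strideAnd_of_lt_base (by omega : g.Bv + 2 < g.Abase)]
    exact g.bheap_indep _ _ _ _ (Or.inl (by omega))
  · rw [strideAnd_rowAddr hjd hj', g.bheap_A _ _ hr hj', g.bheap_A _ _ hr hj',
      uCoord_snoc_snocLit _ _ _ _ _ _ _ _ _ _ (by omega), hG, hψ]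
    by_cases hrow : r / g.H = i
    · have hr2 := (div_eq_iff_row hH).1 hrow
      by_cases hjx : j' = j
      · rw [if_pos ⟨hjx, hr2.1, hr2.2⟩, if_pos ⟨hrow, hjx⟩, ← mod_eq_sub_row hrow]
        simp only [hl, decide_true, Bool.true_and, toNat_and_scatter]
      · rw [if_neg (fun h => hjx h.1), if_neg (fun h => hjx h.2)]
    · rw [if_neg (fun h => hrow ((div_eq_iff_row hH).2 ⟨h.2.1, h.2.2⟩)), if_neg (fun h => hrow h.1)]
  · have hlt := rowAddr_lt (base₀ := g.Bbase) hr hj'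
    rw [strideAnd_of_side_end_le (N := g.N) hjd hi (by omega : g.Abase + g.N * g.d ≤ g.Bbase + r * g.d + j'),
      g.bheap_B _ _ hr hj', g.bheap_B _ _ hr hj']
  · rcases hout with hout | hout
    · rw [strideAnd_of_lt_base (by omega : a < g.Abase)]
      exact g.bheap_indep _ _ _ _ (Or.inl (by omega))
    · rw [strideAnd_of_side_end_le (N := g.N) hjd hi (by omega : g.Abase + g.N * g.d ≤ a)]
      exact g.bheap_indep _ _ _ _ (Or.inr hout)

/-- A first-half literal does not change side `B`. [folklore] -/
theorem bheap_litB_of_lt (G : List (CNF ℕ)) (ψ : CNF ℕ) (C : Clause ℕ) (l : Literal ℕ)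
    (FA : List (CNF ℕ)) (hψ : ψ.length < g.D) (hl : l.1 < g.hh) :
    g.bheap FA (G ++ [ψ ++ [C ++ [l]]]) = g.bheap FA (G ++ [ψ ++ [C]]) := by
  funext a
  unfold bheap
  simp only [vCoord_snoc_snocLit _ _ _ _ _ _ _ _ _ _ hψ, Nat.not_le.2 hl, decide_false,
    Bool.false_and, Bool.not_false, Bool.and_true, ite_self]

/-- **Region lemma (c), side `B`: a second-half literal.** [folklore] -/
theorem bheap_scatterB (hK : g.OK W) (FA G : List (CNF ℕ)) (ψ : CNF ℕ) (C : Clause ℕ) (l : Literal ℕ)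
    {i j : ℕ} (hG : G.length = i) (hψ : ψ.length = j) (hjD : j < g.D)
    (hi : i * g.H + g.H ≤ g.N) (hl : g.hh ≤ l.1) : ∀ a, 100 ≤ a →
      strideAnd (g.bheap FA (G ++ [ψ ++ [C]])) (g.Bbase + i * g.H * g.d + j) g.d (l.1 - g.hh) l.2 g.H a =
        g.bheap FA (G ++ [ψ ++ [C ++ [l]]]) a := by
  obtain ⟨hBv, hA, hB, hE, hNd, -, -, hEXe, -, -, -, hEX, hd, -, -, hdNd, -⟩ := g.facts hK
  have hH : 0 < g.H := by rw [hK.H_eq]; exact Nat.two_pow_pos _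
  have hjd : j < g.d := by omega
  refine g.data_ext hd ⟨?_, ?_, ?_⟩ (fun r j' hr hj' => ?_) (fun r j' hr hj' => ?_) (fun a ha hout => ?_)
  · rw [strideAnd_of_lt_base (by omega : g.Bv < g.Bbase)]
    exact g.bheap_indep _ _ _ _ (Or.inl (by omega))
  · rw [strideAnd_of_lt_base (by omega : g.Bv + 1 < g.Bbase)]
    exact g.bheap_indep _ _ _ _ (Or.inl (by omega))
  · rw [strideAnd_of_lt_base (by omega : g.Bv + 2 < g.Bbase)]
    exact g.bheap_indep _ _ _ _ (Or.inl (by omega))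
  · have hlt := rowAddr_lt (base₀ := g.Abase) hr hj'
    rw [strideAnd_of_lt_base (by omega : g.Abase + r * g.d + j' < g.Bbase), g.bheap_A _ _ hr hj',
      g.bheap_A _ _ hr hj']
  · rw [strideAnd_rowAddr hjd hj', g.bheap_B _ _ hr hj', g.bheap_B _ _ hr hj',
      vCoord_snoc_snocLit _ _ _ _ _ _ _ _ _ _ (by omega), hG, hψ]
    by_cases hrow : r / g.H = i
    · have hr2 := (div_eq_iff_row hH).1 hrow
      by_cases hjx : j' = j
      · rw [if_pos ⟨hjx, hr2.1, hr2.2⟩, if_pos ⟨hrow, hjx⟩, ← mod_eq_sub_row hrow]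
        simp only [hl, decide_true, Bool.true_and, toNat_and_scatter]
      · rw [if_neg (fun h => hjx h.1), if_neg (fun h => hjx h.2)]
    · rw [if_neg (fun h => hrow ((div_eq_iff_row hH).2 ⟨h.2.1, h.2.2⟩)), if_neg (fun h => hrow h.1)]
  · rcases hout with hout | hout
    · rw [strideAnd_of_lt_base (by omega : a < g.Bbase)]
      exact g.bheap_indep _ _ _ _ (Or.inl (by omega))
    · rw [strideAnd_of_side_end_le (N := g.N) hjd hi (by omega : g.Bbase + g.N * g.d ≤ a)]
      exact g.bheap_indep _ _ _ _ (Or.inr hout)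

/-- A second-half literal does not change side `A`. [folklore] -/
theorem bheap_litA_of_le (G : List (CNF ℕ)) (ψ : CNF ℕ) (C : Clause ℕ) (l : Literal ℕ)
    (FB : List (CNF ℕ)) (hψ : ψ.length < g.D) (hl : g.hh ≤ l.1) :
    g.bheap (G ++ [ψ ++ [C ++ [l]]]) FB = g.bheap (G ++ [ψ ++ [C]]) FB := by
  funext a
  unfold bheap
  simp only [uCoord_snoc_snocLit _ _ _ _ _ _ _ _ _ _ hψ, Nat.not_lt.2 hl, decide_false,
    Bool.false_and, Bool.not_false, Bool.and_true, ite_self]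

/-- Every cell of `bheap` above `100` is below `2 ^ W`. [folklore] -/
theorem bheap_lt (hK : g.OK W) (FA FB : List (CNF ℕ)) {a : ℕ} (ha : 100 ≤ a) : g.bheap FA FB a < 2 ^ W := by
  obtain ⟨hBv, hA, hB, hE, hNd, -, hy, -, -, -, -, -, hd, h1W, hNNd, hdNd, hRW⟩ := g.facts hK
  unfold bheap
  split_ifs
  · omega
  · omega
  · omega
  · exact lt_of_le_of_lt (Bool.toNat_le _) h1W
  · exact lt_of_le_of_lt (Bool.toNat_le _) h1W
  · exact hK.base_lt a ha

end region

/-! ### The routines of the parser -/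

/-- Parser registers: formula index `i`, clause index `j`, the row bases of formula `i`. [folklore] -/
def PRegs (i j : ℕ) (m : ℕ → ℕ) : Prop :=
  m 42 = i ∧ m 43 = j ∧ m 44 = g.Abase + i * g.H * g.d ∧ m 45 = g.Bbase + i * g.H * g.d

/-- Start of a literal: polarity into `r46`, advance, `r47 := 0`, `r48 := 1`, digit test. [folklore] -/
def litStartOps : List OpSpec :=
  [(.eq, r 46, r 41, im (g.cd (Γ'.bit true)))] ++ g.advOps ++
    [(.band, r 47, im 0, im 0), (.add, r 48, im 1, im 0)] ++ g.isBitOps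

/-- Set up the scatter on side `A`: `pos := var`, address `rowA + j`, count `H`, `p := 0`. [folklore] -/
def scatAOps : List OpSpec :=
  [(.add, r 54, r 47, im 0), (.add, r 51, r 44, r 43), (.add, r 50, r 22, im 0), (.band, r 56, im 0, im 0)]

/-- Set up the scatter on side `B`: `pos := var - hh`, address `rowB + j`. [folklore] -/
def scatBOps : List OpSpec :=
  [(.sub, r 54, r 47, r 21), (.add, r 51, r 45, r 43), (.add, r 50, r 22, im 0), (.band, r 56, im 0, im 0)]

/-- **One literal**: polarity, digits of the variable, comma, scatter on the proper side, digit
test for the literal loop. [folklore] -/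
def litP : SProg := seqs [block g.litStartOps, g.bitsLoop, block g.advOps,
  block [(.lt, r 52, r 47, r 21)],
  ifz (r 52) (seqs [block scatBOps, scatter]) (seqs [block scatAOps, scatter]),
  block g.isBitOps]

/-- **One clause**: bracket, the two clause-start fills, digit test, literal loop, bracket,
`j += 1`, clause test. [folklore] -/
def clauseP : SProg := seqs [block g.advOps,
  block [(.add, r 51, r 44, r 43), (.add, r 50, r 22, im 0)], fillStride 1,
  block [(.add, r 51, r 45, r 43), (.add, r 50, r 22, im 0)], fillStride 1,
  block g.isBitOps, whilenz (r 49) g.litP,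
  block (g.advOps ++ [(.add, r 43, r 43, im 1), (.eq, r 52, r 41, im (g.cd Γ'.bra))])]

/-- **One formula**: clear the guard of its rows, `j := 0`, skip the digits of `numVars`, comma,
clause loop, blank, `i += 1`, advance the row bases. [folklore] -/
def formulaP : SProg := seqs [
  block [(.add, r 51, r 44, r 39), (.add, r 50, r 22, im 0)], fillStride 0,
  block ([(.band, r 43, im 0, im 0), (.band, r 47, im 0, im 0), (.add, r 48, im 1, im 0)] ++ g.isBitOps),
  g.bitsLoop,
  block (g.advOps ++ [(.eq, r 52, r 41, im (g.cd Γ'.bra))]),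
  whilenz (r 52) g.clauseP,
  block (g.advOps ++ [(.add, r 42, r 42, im 1), (.add, r 44, r 44, r 36), (.add, r 45, r 45, r 36)])]

/-- Pointer initialisation: top of the output stack, first symbol, `i := 0`, row bases. [folklore] -/
def parseInitOps : List OpSpec :=
  [(.add, r 52, r 38, im g.i₁), (.band, r 40, pt 52, pt 52), (.band, r 41, pt 40, pt 40),
    (.band, r 42, im 0, im 0), (.add, r 44, r 34, im 0), (.add, r 45, r 35, im 0)]

/-- **The parser**: pointer initialisation and the formula loop. [folklore] -/
def parsePhase : SProg := seqs [block g.parseInitOps, whilenz (r 41) g.formulaP]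

/-- The parser is query-free. [folklore] -/
theorem parsePhase_queryFree : g.parsePhase.QueryFree := by
  simp [parsePhase, formulaP, clauseP, litP, bitsLoop, fillStride, scatter, seqs, QueryFree,
    block_queryFree]

/-! ### Uniform time bounds -/

/-- Time of one literal (uniformly: the digits of a variable `< n` are at most `size n`). [folklore] -/
def TlitK : ℕ := 8 + ((Nat.size g.n * 11 + 1) + (2 + (1 + (((4 + ((g.H * 9 + 1) + 0)) + 2) + (3 + 0)))))

/-- Time of one clause of width `≤ kw`. [folklore] -/
def TclauseK (kw : ℕ) : ℕ :=
  2 + (2 + ((g.H * 5 + 1) + (2 + ((g.H * 5 + 1) + (3 + ((kw * (g.TlitK + 2) + 1) + (4 + 0)))))))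

/-- Time of one formula with at most `D` clauses of width `≤ kw`. [folklore] -/
def TformulaK (kw : ℕ) : ℕ :=
  2 + ((g.H * 5 + 1) + (6 + ((Nat.size g.n * 11 + 1) + (3 + ((g.D * (g.TclauseK kw + 2) + 1) + (5 + 0))))))

/-- Time of the parser on `nf` formulas. [folklore] -/
def Tparse (kw nf : ℕ) : ℕ := 6 + ((nf * (g.TformulaK kw + 2) + 1) + 0)

/-! ### Grammar bookkeeping -/

/-- The length of a literal on the tape. [folklore] -/
theorem length_sLit (l : Literal ℕ) : (sLit l).length = l.1.bits.length + 2 := by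
  simp [sLit, sBits]

/-- Digits of a number below `n` are at most `size n` many. [folklore] -/
theorem bits_length_le {v n : ℕ} (h : v ≤ n) : v.bits.length ≤ Nat.size n := by
  rw [Nat.size_eq_bits_len]; exact Nat.size_le_size h

/-! ### Certificates of the routines -/

section routineSpecs

variable {O : List ℕ → List ℕ}

set_option linter.unusedSimpArgs false in
/-- **Start of a literal** (symbolic execution of `litStartOps`). [folklore] -/
theorem litStart_spec (hK : g.OK W) {pre rest : List Γ'} {l : Literal ℕ}
    (hstr : g.str = pre ++ sLit l ++ rest) {m : ℕ → ℕ} (hAt : g.At m pre.length)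
    (htape : ∀ s, s ≤ g.len → m (g.addr s) = g.tape s) :
    Achieves W O (block g.litStartOps) m (fun m₁ => m₁ 46 = l.2.toNat ∧
      g.BitsInv m₁ (pre.length + 1) 0 1 l.1.bits 0 m₁ ∧
      (∀ i, i < 100 → i ≠ 40 → i ≠ 41 → i ≠ 46 → i ≠ 47 → i ≠ 48 → i ≠ 49 → i ≠ 52 → m₁ i = m i) ∧
      ∀ a, 100 ≤ a → m₁ a = m a) 8 := by
  have h1W : 1 < 2 ^ W := (g.facts hK).2.2.2.2.2.2.2.2.2.2.2.2.2.1
  obtain ⟨h40, h41⟩ := hAt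
  have hs0 : g.str = pre ++ Γ'.bit l.2 :: (sBits l.1 ++ Γ'.comma :: rest) := by
    rw [hstr]; simp [sLit]
  have hlen : pre.length < g.len := by unfold len; rw [hs0]; simp
  have hsym : g.tape pre.length = g.cd (Γ'.bit l.2) := g.tape_prefix _ _ _ hs0
  have hpol : (if g.tape pre.length = g.cd (Γ'.bit true) then 1 else 0) = l.2.toNat := by
    simp only [g.tape_eq_code_iff hK, g.str_getElem?_prefix _ _ _ hs0]; cases l.2 <;> simp
  refine achieves_block_of_eq (fun m₁ hm₁ => ?_) (by simp only [litStartOps, advOps, isBitOps, List.length_cons, List.length_nil, List.length_append]; omega)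
  unfold litStartOps at hm₁
  rw [execOps_append, execOps_append, execOps_append] at hm₁
  simp (disch := omega) only [execOps_cons, execOps_nil, execOp, Operand.write, Operand.read,
    merge_apply_of_lt, update_merge_of_lt, Function.update_self, Function.update_of_ne, h41,
    BinOp.eval_eq, hpol] at hm₁
  have htp : m (g.addr (pre.length + 1)) = g.tape (pre.length + 1) := htape _ (by omega)
  rw [g.execOps_advOps hK hlen (by simp [h40]) htp] at hm₁
  simp (disch := omega) only [execOps_cons, execOps_nil, execOp, Operand.write, Operand.read,
    merge_apply_of_lt, update_merge_of_lt, Function.update_self, Function.update_of_ne,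
    BinOp.eval_band, Nat.and_self, BinOp.eval_add_of_lt (show 1 + 0 < 2 ^ W by omega)] at hm₁
  obtain ⟨v52, h52⟩ := g.execOps_isBitOps hK m (s := pre.length + 1)
    (R := Function.update (Function.update (Function.update (Function.update (Function.update m 46
      l.2.toNat) 40 (g.addr (pre.length + 1))) 41 (g.tape (pre.length + 1))) 47 0) 48 1) (by simp)
  rw [h52] at hm₁
  subst hm₁
  refine ⟨?_, ⟨⟨?_, ?_⟩, ?_, ?_, ?_, fun i _ _ _ _ _ _ _ => rfl, fun a _ => rfl⟩,
    fun i hi h40' h41' h46' h47' h48' h49' h52' => ?_, fun a ha => ?_⟩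
  · simp (disch := omega) only [merge_apply_of_lt, Function.update_self, Function.update_of_ne]
  · simp (disch := omega) only [merge_apply_of_lt, Function.update_self, Function.update_of_ne]
  · simp (disch := omega) only [merge_apply_of_lt, Function.update_self, Function.update_of_ne]
  · simp (disch := omega) only [merge_apply_of_lt, Function.update_self, Function.update_of_ne]
  · simp (disch := omega) only [merge_apply_of_lt, Function.update_self, Function.update_of_ne, pv,
      Nat.mul_zero]
  · simp (disch := omega) only [merge_apply_of_lt, Function.update_self, Function.update_of_ne,
      Nat.pow_zero, Nat.mul_one]
  · rw [merge_apply_of_lt hi]; simp (disch := omega) only [Function.update_of_ne]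
  · rw [merge_apply_of_le ha]

set_option linter.unusedSimpArgs false in
/-- **One literal.** From the start of `sLit l` on the tape (formula `i = |G|`, clause `j = |ψ|`,
literals `C` already read) with the intended memory of `G ++ [ψ ++ [C]]`, `litP` ends right after the
literal with the digit flag in `r49` and the intended memory of `G ++ [ψ ++ [C ++ [l]]]`. [folklore] -/
theorem litP_spec (hK : g.OK W) {G : List (CNF ℕ)} {ψ : CNF ℕ} {C : Clause ℕ} {l : Literal ℕ}
    {pre rest : List Γ'} (hstr : g.str = pre ++ sLit l ++ rest) {i j : ℕ} (hG : G.length = i)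
    (hψ : ψ.length = j) (hjD : j < g.D) (hi : i * g.H + g.H ≤ g.N) (hl : l.1 < g.n) {m : ℕ → ℕ}
    (hR : g.BRegs m) (hP : g.PRegs i j m) (hAt : g.At m pre.length)
    (hD : ∀ a, 100 ≤ a → m a = g.bheap (G ++ [ψ ++ [C]]) (G ++ [ψ ++ [C]]) a) :
    Achieves W O g.litP m (fun m' => g.BRegs m' ∧ g.PRegs i j m' ∧
      g.At m' (pre.length + (sLit l).length) ∧
      m' 49 = (g.isBitAt (pre.length + (sLit l).length)).toNat ∧
      ∀ a, 100 ≤ a → m' a = g.bheap (G ++ [ψ ++ [C ++ [l]]]) (G ++ [ψ ++ [C ++ [l]]]) a) g.TlitK := by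
  obtain ⟨hBv, hA, hB, hE, hNd, hHd, -, hEXe, hQ, hbot, htop, hEX, hd, h1W, hNNd, hdNd, hRW⟩ := g.facts hK
  have hH : 0 < g.H := by rw [hK.H_eq]; exact Nat.two_pow_pos _
  have hnb := hK.n_bound
  set cur := G ++ [ψ ++ [C]] with hcur
  -- tape facts
  have htape : ∀ s, s ≤ g.len → g.bheap cur cur (g.addr s) = g.tape s := fun s hs => by
    rw [g.bheap_of_not_region _ _ (Or.inr (g.addr_bounds hK s).1)]; exact hK.base_tape s hs
  have hsL : (sLit l).length = l.1.bits.length + 2 := length_sLit l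
  have hs1 : g.str = (pre ++ [Γ'.bit l.2]) ++ l.1.bits.map Γ'.bit ++ (Γ'.comma :: rest) := by
    rw [hstr]; simp [sLit, sBits]
  have hcomma : g.str = (pre ++ Γ'.bit l.2 :: sBits l.1) ++ Γ'.comma :: rest := by
    rw [hstr]; simp [sLit]
  have hlenc : (pre ++ Γ'.bit l.2 :: sBits l.1).length = pre.length + 1 + l.1.bits.length := by
    simp [sBits]; omega
  have hposc : pre.length + 1 + l.1.bits.length < g.len := by unfold len; rw [hcomma]; simp [sBits]; omega
  -- bounds
  have hbits : l.1.bits.length ≤ Nat.size g.n := bits_length_le hl.le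
  have hpow : 0 + 1 * 2 ^ l.1.bits.length < 2 ^ W := by
    rw [Nat.zero_add, Nat.one_mul, Nat.size_eq_bits_len]
    have := two_pow_size_le l.1; omega
  have hrowA : g.Abase + i * g.H * g.d + j + g.H * g.d < 2 ^ W := by
    have h1 : i * g.H * g.d + g.H * g.d ≤ g.N * g.d := by
      rw [← Nat.add_mul]; exact Nat.mul_le_mul_right _ hi
    omega
  have hrowB : g.Bbase + i * g.H * g.d + j + g.H * g.d < 2 ^ W := by
    have h1 : i * g.H * g.d + g.H * g.d ≤ g.N * g.d := by
      rw [← Nat.add_mul]; exact Nat.mul_le_mul_right _ hi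
    omega
  have hHW : g.H < 2 ^ W := by
    have : g.H ≤ g.H * g.d := Nat.le_mul_of_pos_right _ hd
    have h1 : i * g.H * g.d + g.H * g.d ≤ g.N * g.d := by
      rw [← Nat.add_mul]; exact Nat.mul_le_mul_right _ hi
    omega
  obtain ⟨p42, p43, p44, p45⟩ := hP
  unfold litP TlitK
  -- 1. start of the literal
  refine Achieves.seqs_cons (g.litStart_spec hK hstr hAt (fun s hs => by rw [hD _ (g.addr_bounds hK s).2.1, htape s hs]))
    fun m₁ ⟨h46, hI₁, hfr₁, hD₁⟩ => ?_
  -- 2. the digits of the variable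
  refine Achieves.seqs_cons ((g.bitsLoop_spec hK (pre := pre ++ [Γ'.bit l.2]) (rest := Γ'.comma :: rest)
      hs1 (fun b rest' h => by cases h) hpow (fun s hs => by rw [hD₁ _ (g.addr_bounds hK s).2.1,
        hD _ (g.addr_bounds hK s).2.1, htape s hs]) (by simpa using hI₁)).mono (fun _ h => h)
      (by have := Nat.mul_le_mul_right (9 + 2) hbits; omega))
    fun m₂ ⟨hAt₂, h49₂, h47₂, h48₂, hfr₂, hD₂⟩ => ?_
  simp only [List.length_append, List.length_singleton] at hAt₂ h49₂
  rw [pv_bits_length, Nat.zero_add, Nat.one_mul] at h47₂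
  -- registers carried through
  have c46 : m₂ 46 = l.2.toNat := by rw [hfr₂ 46 (by omega) (by omega) (by omega) (by omega) (by omega) (by omega) (by omega), h46]
  have cR : ∀ i, i < 100 → i ≠ 40 → i ≠ 41 → i ≠ 46 → i ≠ 47 → i ≠ 48 → i ≠ 49 → i ≠ 52 → m₂ i = m i :=
    fun i hi a b c d e f k => by rw [hfr₂ i hi a b d e f k, hfr₁ i hi a b c d e f k]
  have cD : ∀ a, 100 ≤ a → m₂ a = g.bheap cur cur a := fun a ha => by rw [hD₂ a ha, hD₁ a ha, hD a ha]
  -- 3. the comma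
  refine Achieves.seqs_cons (R := fun m₃ => g.At m₃ (pre.length + (sLit l).length) ∧ m₃ 47 = l.1 ∧
      m₃ 46 = l.2.toNat ∧ (∀ i, i < 100 → i ≠ 40 → i ≠ 41 → i ≠ 46 → i ≠ 47 → i ≠ 48 → i ≠ 49 → i ≠ 52 →
        m₃ i = m i) ∧ ∀ a, 100 ≤ a → m₃ a = g.bheap cur cur a) (T₁ := 2) ?_ ?_
  · refine achieves_block_of_eq (fun m₃ hm₃ => ?_) (by simp only [advOps, List.length_cons, List.length_nil, List.length_append]; omega)
    obtain ⟨h40₂, h41₂⟩ := hAt₂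
    rw [g.execOps_advOps hK (s := pre.length + 1 + l.1.bits.length) hposc (by rw [h40₂])
      (by rw [cD _ (g.addr_bounds hK _).2.1, htape _ (by omega)])] at hm₃
    subst hm₃
    refine ⟨⟨?_, ?_⟩, ?_, ?_, fun i hi a b c d e f k => ?_, fun a ha => ?_⟩
    · simp (disch := omega) only [merge_apply_of_lt, Function.update_self, Function.update_of_ne, hsL]
      congr 1; omega
    · simp (disch := omega) only [merge_apply_of_lt, Function.update_self, Function.update_of_ne, hsL]
      congr 1; omega
    · simp (disch := omega) only [merge_apply_of_lt, Function.update_self, Function.update_of_ne, h47₂]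
    · simp (disch := omega) only [merge_apply_of_lt, Function.update_self, Function.update_of_ne, c46]
    · rw [merge_apply_of_lt hi]; simp (disch := omega) only [Function.update_of_ne]; exact cR i hi a b c d e f k
    · rw [merge_apply_of_le ha, cD a ha]
  intro m₃ ⟨hAt₃, h47₃, h46₃, hfr₃, hD₃⟩
  have r21 : m₃ 21 = g.hh := by rw [hfr₃ 21 (by omega) (by omega) (by omega) (by omega) (by omega) (by omega) (by omega) (by omega), hR.r21]
  -- 4. the side test
  refine Achieves.seqs_cons (R := fun m₄ => m₄ 52 = (if l.1 < g.hh then 1 else 0) ∧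
      g.At m₄ (pre.length + (sLit l).length) ∧ m₄ 47 = l.1 ∧ m₄ 46 = l.2.toNat ∧
      (∀ i, i < 100 → i ≠ 40 → i ≠ 41 → i ≠ 46 → i ≠ 47 → i ≠ 48 → i ≠ 49 → i ≠ 52 → m₄ i = m i) ∧
      ∀ a, 100 ≤ a → m₄ a = g.bheap cur cur a) (T₁ := 1) ?_ ?_
  · refine achieves_block_of_eq (fun m₄ hm₄ => ?_) le_rfl
    simp (disch := omega) only [execOps_cons, execOps_nil, execOp, Operand.write, Operand.read,
      merge_apply_of_lt, update_merge_of_lt, Function.update_self, Function.update_of_ne, h47₃, r21,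
      BinOp.eval_lt] at hm₄
    subst hm₄
    obtain ⟨h40₃, h41₃⟩ := hAt₃
    refine ⟨?_, ⟨?_, ?_⟩, ?_, ?_, fun i hi a b c d e f k => ?_, fun a ha => ?_⟩
    · simp (disch := omega) only [merge_apply_of_lt, Function.update_self]
    · simp (disch := omega) only [merge_apply_of_lt, Function.update_of_ne, h40₃]
    · simp (disch := omega) only [merge_apply_of_lt, Function.update_of_ne, h41₃]
    · simp (disch := omega) only [merge_apply_of_lt, Function.update_of_ne, h47₃]
    · simp (disch := omega) only [merge_apply_of_lt, Function.update_of_ne, h46₃]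
    · rw [merge_apply_of_lt hi]; simp (disch := omega) only [Function.update_of_ne]; exact hfr₃ i hi a b c d e f k
    · rw [merge_apply_of_le ha, hD₃ a ha]
  intro m₄ ⟨h52₄, hAt₄, h47₄, h46₄, hfr₄, hD₄⟩
  have hR₄ : g.BRegs m₄ := hR.of_frame fun i hi1 hi2 => hfr₄ i (by omega) (by omega) (by omega) (by omega)
    (by omega) (by omega) (by omega) (by omega)
  obtain ⟨r20, r21', r22, r23, r25, r26, r27, r28, r32, r34, r35, r36, r38, r39⟩ := hR₄
  have q43 : m₄ 43 = j := by rw [hfr₄ 43 (by omega) (by omega) (by omega) (by omega) (by omega) (by omega) (by omega) (by omega), p43]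
  have q44 : m₄ 44 = g.Abase + i * g.H * g.d := by
    rw [hfr₄ 44 (by omega) (by omega) (by omega) (by omega) (by omega) (by omega) (by omega) (by omega), p44]
  have q45 : m₄ 45 = g.Bbase + i * g.H * g.d := by
    rw [hfr₄ 45 (by omega) (by omega) (by omega) (by omega) (by omega) (by omega) (by omega) (by omega), p45]
  -- 5. the scatter on the proper side, then 6. the digit test
  refine Achieves.seqs_cons (R := fun m₅ => g.At m₅ (pre.length + (sLit l).length) ∧
      (∀ i, i < 100 → i ≠ 40 → i ≠ 41 → i ≠ 46 → i ≠ 47 → i ≠ 48 → i ≠ 49 → i ≠ 50 → i ≠ 51 → i ≠ 52 →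
        i ≠ 54 → i ≠ 56 → m₅ i = m i) ∧
      ∀ a, 100 ≤ a → m₅ a = g.bheap (G ++ [ψ ++ [C ++ [l]]]) (G ++ [ψ ++ [C ++ [l]]]) a)
    (T₁ := (4 + ((g.H * 9 + 1) + 0)) + 2) (T₂ := 3 + 0) ?_ ?_
  · refine Achieves.ifz (fun h0 => ?_) (fun h1 => ?_)
    · -- side B: `l.1 ≥ hh`
      have hl2 : g.hh ≤ l.1 := by
        simp only [Operand.read, h52₄] at h0; by_contra hlt; rw [if_pos (Nat.not_le.1 hlt)] at h0; omega
      refine Achieves.seqs_cons (R := fun m₅ => m₅ 50 = g.H ∧ m₅ 51 = g.Bbase + i * g.H * g.d + j ∧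
          m₅ 26 = g.d ∧ m₅ 54 = l.1 - g.hh ∧ m₅ 46 = l.2.toNat ∧ m₅ 56 = 0 ∧
          g.At m₅ (pre.length + (sLit l).length) ∧
          (∀ i, i < 100 → i ≠ 40 → i ≠ 41 → i ≠ 46 → i ≠ 47 → i ≠ 48 → i ≠ 49 → i ≠ 50 → i ≠ 51 →
            i ≠ 52 → i ≠ 54 → i ≠ 56 → m₅ i = m i) ∧
          ∀ a, 100 ≤ a → m₅ a = g.bheap cur cur a) (T₁ := 4) (T₂ := (g.H * 9 + 1) + 0) ?_ ?_
      · refine achieves_block_of_eq (fun m₅ hm₅ => ?_) le_rfl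
        unfold scatBOps at hm₅
        simp (disch := omega) only [execOps_cons, execOps_nil, execOp, Operand.write, Operand.read,
          merge_apply_of_lt, update_merge_of_lt, Function.update_self, Function.update_of_ne, h47₄,
          r21', q45, q43, r22, BinOp.eval_sub_of_le hl2 (by omega : l.1 < 2 ^ W),
          BinOp.eval_add_of_lt, BinOp.eval_band, Nat.and_self, Nat.add_zero] at hm₅
        subst hm₅
        obtain ⟨h40₄, h41₄⟩ := hAt₄
        refine ⟨?_, ?_, ?_, ?_, ?_, ?_, ⟨?_, ?_⟩, fun i hi a b c d e f k1 k2 k3 k4 k5 => ?_, fun a ha => ?_⟩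
        · simp (disch := omega) only [merge_apply_of_lt, Function.update_self, Function.update_of_ne]
        · simp (disch := omega) only [merge_apply_of_lt, Function.update_self, Function.update_of_ne]
        · simp (disch := omega) only [merge_apply_of_lt, Function.update_self, Function.update_of_ne, r26]
        · simp (disch := omega) only [merge_apply_of_lt, Function.update_self, Function.update_of_ne]
        · simp (disch := omega) only [merge_apply_of_lt, Function.update_self, Function.update_of_ne, h46₄]
        · simp (disch := omega) only [merge_apply_of_lt, Function.update_self, Function.update_of_ne]
        · simp (disch := omega) only [merge_apply_of_lt, Function.update_self, Function.update_of_ne, h40₄]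
        · simp (disch := omega) only [merge_apply_of_lt, Function.update_self, Function.update_of_ne, h41₄]
        · rw [merge_apply_of_lt hi]; simp (disch := omega) only [Function.update_of_ne]
          exact hfr₄ i hi a b c d e f k3
        · rw [merge_apply_of_le ha, hD₄ a ha]
      · intro m₅ ⟨h50, h51, h26, h54, h46₅, h56, hAt₅, hfr₅, hD₅⟩
        refine Achieves.seqs_cons (T₂ := 0) ((scatter_spec (b := l.2) h50 h51 h26 h54 h46₅ h56 (by omega) (by omega)
          hHW hK.one_le_W (fun a ha => by rw [hD₅ a ha]; exact g.bheap_lt hK _ _ ha)).mono (fun m₆ h6 => ?_) le_rfl)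
          (fun _ h => Achieves.seqs_nil h)
        obtain ⟨_, _, _, hfr₆, hD₆⟩ := h6
        obtain ⟨h40₅, h41₅⟩ := hAt₅
        refine ⟨⟨?_, ?_⟩, fun i hi a b c d e f k1 k2 k3 k4 k5 => ?_, fun a ha => ?_⟩
        · rw [hfr₆ 40 (by omega) (by omega) (by omega) (by omega) (by omega), h40₅]
        · rw [hfr₆ 41 (by omega) (by omega) (by omega) (by omega) (by omega), h41₅]
        · rw [hfr₆ i hi k1 k2 k3 k5, hfr₅ i hi a b c d e f k1 k2 k3 k4 k5]
        · rw [hD₆ a ha, strideAnd_congr_data (by omega) hD₅ _ _ ha,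
            g.bheap_scatterB hK cur G ψ C l hG hψ hjD hi hl2 a ha, g.bheap_litA_of_le G ψ C l _ (by omega) hl2]
    · -- side A: `l.1 < hh`
      have hl2 : l.1 < g.hh := by
        simp only [Operand.read, h52₄] at h1; by_contra hlt; rw [if_neg hlt] at h1; exact h1 rfl
      refine Achieves.seqs_cons (R := fun m₅ => m₅ 50 = g.H ∧ m₅ 51 = g.Abase + i * g.H * g.d + j ∧
          m₅ 26 = g.d ∧ m₅ 54 = l.1 ∧ m₅ 46 = l.2.toNat ∧ m₅ 56 = 0 ∧
          g.At m₅ (pre.length + (sLit l).length) ∧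
          (∀ i, i < 100 → i ≠ 40 → i ≠ 41 → i ≠ 46 → i ≠ 47 → i ≠ 48 → i ≠ 49 → i ≠ 50 → i ≠ 51 →
            i ≠ 52 → i ≠ 54 → i ≠ 56 → m₅ i = m i) ∧
          ∀ a, 100 ≤ a → m₅ a = g.bheap cur cur a) (T₁ := 4) (T₂ := (g.H * 9 + 1) + 0) ?_ ?_
      · refine achieves_block_of_eq (fun m₅ hm₅ => ?_) le_rfl
        unfold scatAOps at hm₅
        simp (disch := omega) only [execOps_cons, execOps_nil, execOp, Operand.write, Operand.read,
          merge_apply_of_lt, update_merge_of_lt, Function.update_self, Function.update_of_ne, h47₄,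
          q44, q43, r22, BinOp.eval_add_of_lt, BinOp.eval_band, Nat.and_self, Nat.add_zero] at hm₅
        subst hm₅
        obtain ⟨h40₄, h41₄⟩ := hAt₄
        refine ⟨?_, ?_, ?_, ?_, ?_, ?_, ⟨?_, ?_⟩, fun i hi a b c d e f k1 k2 k3 k4 k5 => ?_, fun a ha => ?_⟩
        · simp (disch := omega) only [merge_apply_of_lt, Function.update_self, Function.update_of_ne]
        · simp (disch := omega) only [merge_apply_of_lt, Function.update_self, Function.update_of_ne]
        · simp (disch := omega) only [merge_apply_of_lt, Function.update_self, Function.update_of_ne, r26]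
        · simp (disch := omega) only [merge_apply_of_lt, Function.update_self, Function.update_of_ne]
        · simp (disch := omega) only [merge_apply_of_lt, Function.update_self, Function.update_of_ne, h46₄]
        · simp (disch := omega) only [merge_apply_of_lt, Function.update_self, Function.update_of_ne]
        · simp (disch := omega) only [merge_apply_of_lt, Function.update_self, Function.update_of_ne, h40₄]
        · simp (disch := omega) only [merge_apply_of_lt, Function.update_self, Function.update_of_ne, h41₄]
        · rw [merge_apply_of_lt hi]; simp (disch := omega) only [Function.update_of_ne]
          exact hfr₄ i hi a b c d e f k3
        · rw [merge_apply_of_le ha, hD₄ a ha]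
      · intro m₅ ⟨h50, h51, h26, h54, h46₅, h56, hAt₅, hfr₅, hD₅⟩
        refine Achieves.seqs_cons (T₂ := 0) ((scatter_spec (b := l.2) h50 h51 h26 h54 h46₅ h56 (by omega) (by omega)
          hHW hK.one_le_W (fun a ha => by rw [hD₅ a ha]; exact g.bheap_lt hK _ _ ha)).mono (fun m₆ h6 => ?_) le_rfl)
          (fun _ h => Achieves.seqs_nil h)
        obtain ⟨_, _, _, hfr₆, hD₆⟩ := h6
        obtain ⟨h40₅, h41₅⟩ := hAt₅
        refine ⟨⟨?_, ?_⟩, fun i hi a b c d e f k1 k2 k3 k4 k5 => ?_, fun a ha => ?_⟩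
        · rw [hfr₆ 40 (by omega) (by omega) (by omega) (by omega) (by omega), h40₅]
        · rw [hfr₆ 41 (by omega) (by omega) (by omega) (by omega) (by omega), h41₅]
        · rw [hfr₆ i hi k1 k2 k3 k5, hfr₅ i hi a b c d e f k1 k2 k3 k4 k5]
        · rw [hD₆ a ha, strideAnd_congr_data (by omega) hD₅ _ _ ha,
            g.bheap_scatterA hK G ψ C l cur hG hψ hjD hi hl2 a ha, g.bheap_litB_of_lt G ψ C l _ (by omega) hl2]
  · intro m₅ ⟨hAt₅, hfr₅, hD₅⟩
    refine Achieves.seqs_cons (T₂ := 0) (achieves_block_of_eq (fun m₆ hm₆ => ?_)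
      (by simp only [isBitOps, List.length_cons, List.length_nil]; omega)) (fun _ h => Achieves.seqs_nil h)
    obtain ⟨h40₅, h41₅⟩ := hAt₅
    obtain ⟨v52, h52⟩ := g.execOps_isBitOps hK m₅ (R := m₅) h41₅
    rw [h52] at hm₆
    subst hm₆
    have hfr : ∀ i, 20 ≤ i → i ≤ 45 → i ≠ 40 → i ≠ 41 →
        merge (Function.update (Function.update (Function.update m₅ 49
          (if g.tape (pre.length + (sLit l).length) = g.cd (Γ'.bit false) then 1 else 0)) 52 v52) 49
          (g.isBitAt (pre.length + (sLit l).length)).toNat) m₅ i = m i := fun i h1 h2 h3 h4 => by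
      rw [merge_apply_of_lt (by omega)]; simp (disch := omega) only [Function.update_of_ne]
      exact hfr₅ i (by omega) h3 h4 (by omega) (by omega) (by omega) (by omega) (by omega) (by omega)
        (by omega) (by omega) (by omega)
    refine ⟨hR.of_frame fun i h1 h2 => hfr i h1 (by omega) (by omega) (by omega), ⟨?_, ?_, ?_, ?_⟩,
      ⟨?_, ?_⟩, ?_, fun a ha => ?_⟩
    · rw [hfr 42 (by omega) (by omega) (by omega) (by omega), p42]
    · rw [hfr 43 (by omega) (by omega) (by omega) (by omega), p43]
    · rw [hfr 44 (by omega) (by omega) (by omega) (by omega), p44]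
    · rw [hfr 45 (by omega) (by omega) (by omega) (by omega), p45]
    · simp (disch := omega) only [merge_apply_of_lt, Function.update_of_ne, h40₅]
    · simp (disch := omega) only [merge_apply_of_lt, Function.update_of_ne, h41₅]
    · simp (disch := omega) only [merge_apply_of_lt, Function.update_self]
    · rw [merge_apply_of_le ha, hD₅ a ha]

/-- **The literal loop of a clause.** [folklore] -/
theorem litLoop_spec (hK : g.OK W) {G : List (CNF ℕ)} {ψ : CNF ℕ} {C : Clause ℕ} {pre rest : List Γ'}
    (hstr : g.str = pre ++ C.flatMap sLit ++ rest) (hrest : ∀ b rest', rest ≠ Γ'.bit b :: rest')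
    {i j : ℕ} (hG : G.length = i) (hψ : ψ.length = j) (hjD : j < g.D) (hi : i * g.H + g.H ≤ g.N)
    (hvars : ∀ l ∈ C, l.1 < g.n) {kw : ℕ} (hkw : C.length ≤ kw) {m : ℕ → ℕ}
    (hR : g.BRegs m) (hP : g.PRegs i j m) (hAt : g.At m pre.length)
    (h49 : m 49 = (g.isBitAt pre.length).toNat)
    (hD : ∀ a, 100 ≤ a → m a = g.bheap (G ++ [ψ ++ [[]]]) (G ++ [ψ ++ [[]]]) a) :
    Achieves W O (whilenz (r 49) g.litP) m (fun m' => g.BRegs m' ∧ g.PRegs i j m' ∧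
      g.At m' (pre.length + (C.flatMap sLit).length) ∧
      m' 49 = (g.isBitAt (pre.length + (C.flatMap sLit).length)).toNat ∧
      ∀ a, 100 ≤ a → m' a = g.bheap (G ++ [ψ ++ [C]]) (G ++ [ψ ++ [C]]) a) (kw * (g.TlitK + 2) + 1) := by
  -- splitting the literal list at `t`
  have hsplit : ∀ t (ht : t < C.length), g.str = (pre ++ (C.take t).flatMap sLit) ++ sLit (C[t]'(by omega)) ++
      ((C.drop (t + 1)).flatMap sLit ++ rest) := by
    intro t ht
    have hC : C = C.take t ++ C[t] :: C.drop (t + 1) := by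
      conv_lhs => rw [← List.take_append_drop t C, List.drop_eq_getElem_cons ht]
    have hfm : C.flatMap sLit = (C.take t).flatMap sLit ++ (sLit C[t] ++ (C.drop (t + 1)).flatMap sLit) := by
      conv_lhs => rw [hC]
      rw [List.flatMap_append, List.flatMap_cons]
    rw [hstr, hfm]; simp only [List.append_assoc]
  refine Achieves.whilenz C.length g.TlitK
    (fun t m' => g.BRegs m' ∧ g.PRegs i j m' ∧ g.At m' (pre.length + ((C.take t).flatMap sLit).length) ∧
      m' 49 = (g.isBitAt (pre.length + ((C.take t).flatMap sLit).length)).toNat ∧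
      ∀ a, 100 ≤ a → m' a = g.bheap (G ++ [ψ ++ [C.take t]]) (G ++ [ψ ++ [C.take t]]) a)
    ?_ ?_ ⟨hR, hP, by simpa using hAt, by simpa using h49, by simpa using hD⟩ ?_
    (by have := Nat.mul_le_mul_right (g.TlitK + 2) hkw; omega)
  rotate_left 2
  · rintro m' ⟨hR', hP', hAt', h49', hD'⟩
    exact ⟨hR', hP', by simpa using hAt', by simpa using h49', by simpa using hD'⟩
  · intro t ht m' hI'
    obtain ⟨hR', hP', hAt', h49', hD'⟩ := hI'
    refine ⟨?_, ?_⟩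
    · -- the test: a literal starts with a digit
      have h1 : g.str = (pre ++ (C.take t).flatMap sLit) ++ Γ'.bit (C[t]'(by omega)).2 ::
          (sBits (C[t]'(by omega)).1 ++ Γ'.comma :: ((C.drop (t + 1)).flatMap sLit ++ rest)) := by
        rw [hsplit t ht]; simp [sLit]
      have := g.isBitAt_of_prefix _ _ _ h1
      simp only [List.length_append] at this
      simp only [Operand.read, h49', this]; decide
    · -- the body: one literal
      have hl : (C[t]'(by omega)).1 < g.n := hvars _ (List.getElem_mem _)
      refine (g.litP_spec hK (hsplit t ht) hG hψ hjD hi hl hR' hP'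
        (by simpa using hAt') (by simpa using hD')).mono (fun m'' hI'' => ?_) le_rfl
      obtain ⟨hR'', hP'', hAt'', h49'', hD''⟩ := hI''
      have htake : C.take (t + 1) = C.take t ++ [C[t]'(by omega)] := List.take_succ_eq_append_getElem ht
      have hlen : pre.length + ((C.take (t + 1)).flatMap sLit).length =
          (pre ++ (C.take t).flatMap sLit).length + (sLit (C[t]'(by omega))).length := by
        rw [htake]
        simp only [List.flatMap_append, List.flatMap_cons, List.flatMap_nil, List.append_nil, List.length_append]
        omega
      refine ⟨hR'', hP'', by rw [hlen]; exact hAt'', by rw [hlen]; exact h49'', fun a ha => ?_⟩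
      rw [hD'' a ha, htake]
  · -- the exit: after the last literal there is no digit
    rintro m' ⟨hR', hP', hAt', h49', hD'⟩
    have h1 : g.str = (pre ++ (C.take C.length).flatMap sLit) ++ rest := by rw [List.take_length, hstr]
    have := g.isBitAt_false_of_prefix _ _ h1 hrest
    simp only [List.length_append] at this
    simp only [Operand.read, h49', this, Bool.toNat_false]

/-- The clause test in closed form: is the symbol at position `s` an opening bracket? [folklore] -/
def braFlag (s : ℕ) : ℕ := if g.str[s]? = some Γ'.bra then 1 else 0

/-- The length of a clause on the tape. [folklore] -/
theorem length_sClause (C : Clause ℕ) : (sClause C).length = (C.flatMap sLit).length + 2 := by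
  simp [sClause]

set_option linter.unusedSimpArgs false in
/-- **One clause.** [folklore] -/
theorem clauseP_spec (hK : g.OK W) {G : List (CNF ℕ)} {ψ : CNF ℕ} {C : Clause ℕ} {pre rest : List Γ'}
    (hstr : g.str = pre ++ sClause C ++ rest) {i j : ℕ} (hG : G.length = i) (hψ : ψ.length = j)
    (hjD : j < g.D) (hi : i * g.H + g.H ≤ g.N) (hvars : ∀ l ∈ C, l.1 < g.n) {kw : ℕ}
    (hkw : C.length ≤ kw) {m : ℕ → ℕ} (hR : g.BRegs m) (hP : g.PRegs i j m) (hAt : g.At m pre.length)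
    (hD : ∀ a, 100 ≤ a → m a = g.bheap (G ++ [ψ]) (G ++ [ψ]) a) :
    Achieves W O g.clauseP m (fun m' => g.BRegs m' ∧ g.PRegs i (j + 1) m' ∧
      g.At m' (pre.length + (sClause C).length) ∧ m' 52 = g.braFlag (pre.length + (sClause C).length) ∧
      ∀ a, 100 ≤ a → m' a = g.bheap (G ++ [ψ ++ [C]]) (G ++ [ψ ++ [C]]) a) (g.TclauseK kw) := by
  obtain ⟨hBv, hA, hB, hE, hNd, hHd, -, hEXe, hQ, hbot, htop, hEX, hd, h1W, hNNd, hdNd, hRW⟩ := g.facts hK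
  have hH : 0 < g.H := by rw [hK.H_eq]; exact Nat.two_pow_pos _
  -- tape facts
  have htape : ∀ (L L' : List (CNF ℕ)) s, s ≤ g.len → g.bheap L L' (g.addr s) = g.tape s := fun L L' s hs => by
    rw [g.bheap_of_not_region _ _ (Or.inr (g.addr_bounds hK s).1)]; exact hK.base_tape s hs
  have hsC : (sClause C).length = (C.flatMap sLit).length + 2 := length_sClause C
  have hs0 : g.str = pre ++ Γ'.bra :: (C.flatMap sLit ++ Γ'.ket :: rest) := by rw [hstr]; simp [sClause]
  have hsL : g.str = (pre ++ [Γ'.bra]) ++ C.flatMap sLit ++ (Γ'.ket :: rest) := by rw [hstr]; simp [sClause]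
  have hsK : g.str = (pre ++ Γ'.bra :: C.flatMap sLit) ++ Γ'.ket :: rest := by rw [hstr]; simp [sClause]
  have hlen0 : pre.length < g.len := by unfold len; rw [hs0]; simp
  have hlenK : pre.length + 1 + (C.flatMap sLit).length < g.len := by unfold len; rw [hsK]; simp; omega
  have hrow1 : i * g.H * g.d + g.H * g.d ≤ g.N * g.d := by rw [← Nat.add_mul]; exact Nat.mul_le_mul_right _ hi
  have hHW : g.H < 2 ^ W := by have : g.H ≤ g.H * g.d := Nat.le_mul_of_pos_right _ hd; omega
  have hjd : j < g.d := by omega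
  obtain ⟨p42, p43, p44, p45⟩ := hP
  obtain ⟨h40, h41⟩ := hAt
  unfold clauseP TclauseK
  -- 1. the bracket
  refine Achieves.seqs_cons (R := fun m₁ => g.At m₁ (pre.length + 1) ∧ (∀ i, i < 100 → i ≠ 40 → i ≠ 41 → m₁ i = m i) ∧
      ∀ a, 100 ≤ a → m₁ a = g.bheap (G ++ [ψ]) (G ++ [ψ]) a) (T₁ := 2) ?_ ?_
  · refine achieves_block_of_eq (fun m₁ hm₁ => ?_) (by simp only [advOps, List.length_cons, List.length_nil, List.length_append]; omega)
    rw [g.execOps_advOps hK hlen0 (by rw [h40]) (by rw [hD _ (g.addr_bounds hK _).2.1, htape _ _ _ (by omega)])] at hm₁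
    · subst hm₁
      refine ⟨⟨?_, ?_⟩, fun i hi a b => ?_, fun a ha => ?_⟩
      · simp (disch := omega) only [merge_apply_of_lt, Function.update_self, Function.update_of_ne]
      · simp (disch := omega) only [merge_apply_of_lt, Function.update_self, Function.update_of_ne]
      · rw [merge_apply_of_lt hi]; simp (disch := omega) only [Function.update_of_ne]
      · rw [merge_apply_of_le ha, hD a ha]
  intro m₁ ⟨hAt₁, hfr₁, hD₁⟩
  have hR₁ : g.BRegs m₁ := hR.of_frame fun i h1 h2 => hfr₁ i (by omega) (by omega) (by omega)
  -- 2. the clause-start fill on side A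
  refine Achieves.seqs_cons (R := fun m₂ => m₂ 50 = g.H ∧ m₂ 51 = g.Abase + i * g.H * g.d + j ∧ m₂ 26 = g.d ∧
      g.At m₂ (pre.length + 1) ∧ (∀ i, i < 100 → i ≠ 40 → i ≠ 41 → i ≠ 50 → i ≠ 51 → m₂ i = m i) ∧
      ∀ a, 100 ≤ a → m₂ a = g.bheap (G ++ [ψ]) (G ++ [ψ]) a) (T₁ := 2) ?_ ?_
  · refine achieves_block_of_eq (fun m₂ hm₂ => ?_) le_rfl
    have q44 : m₁ 44 = g.Abase + i * g.H * g.d := by rw [hfr₁ 44 (by omega) (by omega) (by omega), p44]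
    have q43 : m₁ 43 = j := by rw [hfr₁ 43 (by omega) (by omega) (by omega), p43]
    have q22 : m₁ 22 = g.H := hR₁.r22
    simp (disch := omega) only [execOps_cons, execOps_nil, execOp, Operand.write, Operand.read,
      merge_apply_of_lt, update_merge_of_lt, Function.update_self, Function.update_of_ne, q44, q43, q22,
      BinOp.eval_add_of_lt, Nat.add_zero] at hm₂
    subst hm₂
    obtain ⟨h40₁, h41₁⟩ := hAt₁
    refine ⟨?_, ?_, ?_, ⟨?_, ?_⟩, fun i hi a b c d' => ?_, fun a ha => ?_⟩
    · simp (disch := omega) only [merge_apply_of_lt, Function.update_self, Function.update_of_ne]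
    · simp (disch := omega) only [merge_apply_of_lt, Function.update_self, Function.update_of_ne]
    · simp (disch := omega) only [merge_apply_of_lt, Function.update_self, Function.update_of_ne, hR₁.r26]
    · simp (disch := omega) only [merge_apply_of_lt, Function.update_self, Function.update_of_ne, h40₁]
    · simp (disch := omega) only [merge_apply_of_lt, Function.update_self, Function.update_of_ne, h41₁]
    · rw [merge_apply_of_lt hi]; simp (disch := omega) only [Function.update_of_ne]; exact hfr₁ i hi a b
    · rw [merge_apply_of_le ha, hD₁ a ha]
  intro m₂ ⟨h50, h51, h26, hAt₂, hfr₂, hD₂⟩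
  refine Achieves.seqs_cons ((fillStride_spec (v := 1) h50 h51 h26 (by omega) (by omega) hHW).mono
    (fun m₃ h => h) le_rfl) fun m₃ ⟨_, _, hfr₃, hD₃⟩ => ?_
  have hD₃' : ∀ a, 100 ≤ a → m₃ a = g.bheap (G ++ [ψ ++ [[]]]) (G ++ [ψ]) a := fun a ha => by
    rw [hD₃ a ha, strideSet_congr_data (by omega) hD₂ _ _ ha, g.bheap_clauseStartA hK G ψ _ hG hψ hjD hi a ha]
  have hfr₃' : ∀ i, i < 100 → i ≠ 40 → i ≠ 41 → i ≠ 50 → i ≠ 51 → m₃ i = m i := fun i hi a b c d' => by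
    rw [hfr₃ i hi c d', hfr₂ i hi a b c d']
  have hAt₃ : g.At m₃ (pre.length + 1) :=
    ⟨by rw [hfr₃ 40 (by omega) (by omega) (by omega), hAt₂.1], by rw [hfr₃ 41 (by omega) (by omega) (by omega), hAt₂.2]⟩
  have hR₃ : g.BRegs m₃ := hR.of_frame fun i h1 h2 => hfr₃' i (by omega) (by omega) (by omega) (by omega) (by omega)
  -- 3. the clause-start fill on side B
  refine Achieves.seqs_cons (R := fun m₄ => m₄ 50 = g.H ∧ m₄ 51 = g.Bbase + i * g.H * g.d + j ∧ m₄ 26 = g.d ∧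
      g.At m₄ (pre.length + 1) ∧ (∀ i, i < 100 → i ≠ 40 → i ≠ 41 → i ≠ 50 → i ≠ 51 → m₄ i = m i) ∧
      ∀ a, 100 ≤ a → m₄ a = g.bheap (G ++ [ψ ++ [[]]]) (G ++ [ψ]) a) (T₁ := 2) ?_ ?_
  · refine achieves_block_of_eq (fun m₄ hm₄ => ?_) le_rfl
    have q45 : m₃ 45 = g.Bbase + i * g.H * g.d := by rw [hfr₃' 45 (by omega) (by omega) (by omega) (by omega) (by omega), p45]
    have q43 : m₃ 43 = j := by rw [hfr₃' 43 (by omega) (by omega) (by omega) (by omega) (by omega), p43]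
    have q22 : m₃ 22 = g.H := hR₃.r22
    simp (disch := omega) only [execOps_cons, execOps_nil, execOp, Operand.write, Operand.read,
      merge_apply_of_lt, update_merge_of_lt, Function.update_self, Function.update_of_ne, q45, q43, q22,
      BinOp.eval_add_of_lt, Nat.add_zero] at hm₄
    subst hm₄
    obtain ⟨h40₃, h41₃⟩ := hAt₃
    refine ⟨?_, ?_, ?_, ⟨?_, ?_⟩, fun i hi a b c d' => ?_, fun a ha => ?_⟩
    · simp (disch := omega) only [merge_apply_of_lt, Function.update_self, Function.update_of_ne]
    · simp (disch := omega) only [merge_apply_of_lt, Function.update_self, Function.update_of_ne]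
    · simp (disch := omega) only [merge_apply_of_lt, Function.update_self, Function.update_of_ne, hR₃.r26]
    · simp (disch := omega) only [merge_apply_of_lt, Function.update_self, Function.update_of_ne, h40₃]
    · simp (disch := omega) only [merge_apply_of_lt, Function.update_self, Function.update_of_ne, h41₃]
    · rw [merge_apply_of_lt hi]; simp (disch := omega) only [Function.update_of_ne]; exact hfr₃' i hi a b c d'
    · rw [merge_apply_of_le ha, hD₃' a ha]
  intro m₄ ⟨h50', h51', h26', hAt₄, hfr₄, hD₄⟩
  refine Achieves.seqs_cons ((fillStride_spec (v := 1) h50' h51' h26' (by omega) (by omega) hHW).mono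
    (fun m₅ h => h) le_rfl) fun m₅ ⟨_, _, hfr₅, hD₅⟩ => ?_
  have hD₅' : ∀ a, 100 ≤ a → m₅ a = g.bheap (G ++ [ψ ++ [[]]]) (G ++ [ψ ++ [[]]]) a := fun a ha => by
    rw [hD₅ a ha, strideSet_congr_data (by omega) hD₄ _ _ ha, g.bheap_clauseStartB hK _ G ψ hG hψ hjD hi a ha]
  have hfr₅' : ∀ i, i < 100 → i ≠ 40 → i ≠ 41 → i ≠ 50 → i ≠ 51 → m₅ i = m i := fun i hi a b c d' => by
    rw [hfr₅ i hi c d', hfr₄ i hi a b c d']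
  have hAt₅ : g.At m₅ (pre.length + 1) :=
    ⟨by rw [hfr₅ 40 (by omega) (by omega) (by omega), hAt₄.1], by rw [hfr₅ 41 (by omega) (by omega) (by omega), hAt₄.2]⟩
  have hR₅ : g.BRegs m₅ := hR.of_frame fun i h1 h2 => hfr₅' i (by omega) (by omega) (by omega) (by omega) (by omega)
  have hP₅ : g.PRegs i j m₅ := ⟨by rw [hfr₅' 42 (by omega) (by omega) (by omega) (by omega) (by omega), p42],
    by rw [hfr₅' 43 (by omega) (by omega) (by omega) (by omega) (by omega), p43],
    by rw [hfr₅' 44 (by omega) (by omega) (by omega) (by omega) (by omega), p44],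
    by rw [hfr₅' 45 (by omega) (by omega) (by omega) (by omega) (by omega), p45]⟩
  -- 4. the digit test
  refine Achieves.seqs_cons (R := fun m₆ => g.BRegs m₆ ∧ g.PRegs i j m₆ ∧ g.At m₆ (pre.length + 1) ∧
      m₆ 49 = (g.isBitAt (pre.length + 1)).toNat ∧
      ∀ a, 100 ≤ a → m₆ a = g.bheap (G ++ [ψ ++ [[]]]) (G ++ [ψ ++ [[]]]) a) (T₁ := 3) ?_ ?_
  · refine achieves_block_of_eq (fun m₆ hm₆ => ?_) (by simp only [isBitOps, List.length_cons, List.length_nil]; omega)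
    obtain ⟨h40₅, h41₅⟩ := hAt₅
    obtain ⟨v52, h52⟩ := g.execOps_isBitOps hK m₅ (R := m₅) h41₅
    rw [h52] at hm₆
    subst hm₆
    have hfr : ∀ i, i < 100 → i ≠ 49 → i ≠ 52 →
        merge (Function.update (Function.update (Function.update m₅ 49
          (if g.tape (pre.length + 1) = g.cd (Γ'.bit false) then 1 else 0)) 52 v52) 49
          (g.isBitAt (pre.length + 1)).toNat) m₅ i = m₅ i := fun i h1 h2 h3 => by
      rw [merge_apply_of_lt (by omega)]; simp (disch := omega) only [Function.update_of_ne]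
    refine ⟨hR₅.of_frame fun i h1 h2 => hfr i (by omega) (by omega) (by omega),
      ⟨by rw [hfr 42 (by omega) (by omega) (by omega), hP₅.1], by rw [hfr 43 (by omega) (by omega) (by omega), hP₅.2.1],
       by rw [hfr 44 (by omega) (by omega) (by omega), hP₅.2.2.1], by rw [hfr 45 (by omega) (by omega) (by omega), hP₅.2.2.2]⟩,
      ⟨by rw [hfr 40 (by omega) (by omega) (by omega), h40₅], by rw [hfr 41 (by omega) (by omega) (by omega), h41₅]⟩,
      ?_, fun a ha => ?_⟩
    · simp (disch := omega) only [merge_apply_of_lt, Function.update_self]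
    · rw [merge_apply_of_le ha, hD₅' a ha]
  intro m₆ ⟨hR₆, hP₆, hAt₆, h49₆, hD₆⟩
  -- 5. the literals
  refine Achieves.seqs_cons (g.litLoop_spec hK (pre := pre ++ [Γ'.bra]) (rest := Γ'.ket :: rest) hsL
    (fun b rest' h => by cases h) hG hψ hjD hi hvars hkw hR₆ hP₆ (by simpa using hAt₆) (by simpa using h49₆) hD₆)
    fun m₇ ⟨hR₇, hP₇, hAt₇, _, hD₇⟩ => ?_
  simp only [List.length_append, List.length_singleton] at hAt₇
  -- 6. the closing bracket, `j += 1`, the clause test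
  refine Achieves.seqs_cons (T₂ := 0) ?_ fun m₈ h => Achieves.seqs_nil h
  refine achieves_block_of_eq (fun m₈ hm₈ => ?_) (by simp only [advOps, List.length_cons, List.length_nil, List.length_append]; omega)
  obtain ⟨h40₇, h41₇⟩ := hAt₇
  obtain ⟨q42, q43, q44, q45⟩ := hP₇
  rw [execOps_append, g.execOps_advOps hK (s := pre.length + 1 + (C.flatMap sLit).length) hlenK (by rw [h40₇])
    (by rw [hD₇ _ (g.addr_bounds hK _).2.1, htape _ _ _ (by omega)])] at hm₈
  · simp (disch := omega) only [execOps_cons, execOps_nil, execOp, Operand.write, Operand.read,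
      merge_apply_of_lt, update_merge_of_lt, Function.update_self, Function.update_of_ne, q43,
      BinOp.eval_add_of_lt, BinOp.eval_eq] at hm₈
    subst hm₈
    have hpos : pre.length + 1 + (C.flatMap sLit).length + 1 = pre.length + (sClause C).length := by rw [hsC]; omega
    have hfr : ∀ i, i < 100 → i ≠ 40 → i ≠ 41 → i ≠ 43 → i ≠ 52 →
        merge (Function.update (Function.update (Function.update (Function.update m₇ 40
          (g.addr (pre.length + 1 + (C.flatMap sLit).length + 1))) 41
          (g.tape (pre.length + 1 + (C.flatMap sLit).length + 1))) 43 (j + 1)) 52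
          (if g.tape (pre.length + 1 + (C.flatMap sLit).length + 1) = g.cd Γ'.bra then 1 else 0)) m₇ i = m₇ i :=
      fun i hi a b c d' => by rw [merge_apply_of_lt hi]; simp (disch := omega) only [Function.update_of_ne]
    refine ⟨hR₇.of_frame fun i h1 h2 => hfr i (by omega) (by omega) (by omega) (by omega) (by omega),
      ⟨by rw [hfr 42 (by omega) (by omega) (by omega) (by omega) (by omega), q42], ?_,
       by rw [hfr 44 (by omega) (by omega) (by omega) (by omega) (by omega), q44],
       by rw [hfr 45 (by omega) (by omega) (by omega) (by omega) (by omega), q45]⟩, ⟨?_, ?_⟩, ?_, fun a ha => ?_⟩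
    · simp (disch := omega) only [merge_apply_of_lt, Function.update_self, Function.update_of_ne]
    · simp (disch := omega) only [merge_apply_of_lt, Function.update_self, Function.update_of_ne, hpos]
    · simp (disch := omega) only [merge_apply_of_lt, Function.update_self, Function.update_of_ne, hpos]
    · simp (disch := omega) only [merge_apply_of_lt, Function.update_self, Function.update_of_ne, hpos]
      simp only [braFlag, g.tape_eq_code_iff hK]
    · rw [merge_apply_of_le ha, hD₇ a ha]

end routineSpecs

section loopSpecs

variable {O : List ℕ → List ℕ}

/-- **The clause loop of a formula.** [folklore] -/
theorem clauseLoop_spec (hK : g.OK W) {G : List (CNF ℕ)} {cls : CNF ℕ} {pre rest : List Γ'}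
    (hstr : g.str = pre ++ cls.flatMap sClause ++ Γ'.blank :: rest) {i : ℕ} (hG : G.length = i)
    (hD' : cls.length ≤ g.D) (hi : i * g.H + g.H ≤ g.N) (hvars : ∀ C ∈ cls, ∀ l ∈ C, l.1 < g.n) {kw : ℕ}
    (hkw : ∀ C ∈ cls, C.length ≤ kw) {m : ℕ → ℕ} (hR : g.BRegs m) (hP : g.PRegs i 0 m)
    (hAt : g.At m pre.length) (h52 : m 52 = g.braFlag pre.length)
    (hD : ∀ a, 100 ≤ a → m a = g.bheap (G ++ [[]]) (G ++ [[]]) a) :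
    Achieves W O (whilenz (r 52) g.clauseP) m (fun m' => g.BRegs m' ∧ g.PRegs i cls.length m' ∧
      g.At m' (pre.length + (cls.flatMap sClause).length) ∧
      ∀ a, 100 ≤ a → m' a = g.bheap (G ++ [cls]) (G ++ [cls]) a) (g.D * (g.TclauseK kw + 2) + 1) := by
  have hsplit : ∀ q (hq : q < cls.length), g.str = (pre ++ (cls.take q).flatMap sClause) ++ sClause (cls[q]'(by omega)) ++
      ((cls.drop (q + 1)).flatMap sClause ++ Γ'.blank :: rest) := by
    intro q hq
    have hC : cls = cls.take q ++ cls[q] :: cls.drop (q + 1) := by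
      conv_lhs => rw [← List.take_append_drop q cls, List.drop_eq_getElem_cons hq]
    have hfm : cls.flatMap sClause = (cls.take q).flatMap sClause ++ (sClause cls[q] ++ (cls.drop (q + 1)).flatMap sClause) := by
      conv_lhs => rw [hC]
      rw [List.flatMap_append, List.flatMap_cons]
    rw [hstr, hfm]; simp only [List.append_assoc]
  refine Achieves.whilenz cls.length (g.TclauseK kw)
    (fun q m' => g.BRegs m' ∧ g.PRegs i q m' ∧ g.At m' (pre.length + ((cls.take q).flatMap sClause).length) ∧
      m' 52 = g.braFlag (pre.length + ((cls.take q).flatMap sClause).length) ∧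
      ∀ a, 100 ≤ a → m' a = g.bheap (G ++ [cls.take q]) (G ++ [cls.take q]) a)
    ?_ ?_ ⟨hR, hP, by simpa using hAt, by simpa using h52, by simpa using hD⟩ ?_
    (by have := Nat.mul_le_mul_right (g.TclauseK kw + 2) hD'; omega)
  rotate_left 2
  · rintro m' ⟨hR', hP', hAt', _, hD'⟩
    exact ⟨hR', by simpa using hP', by simpa using hAt', by simpa using hD'⟩
  · intro q hq m' hI'
    obtain ⟨hR', hP', hAt', h52', hD'⟩ := hI'
    have hlt : (cls.take q).length = q := by rw [List.length_take]; exact Nat.min_eq_left hq.le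
    have hqD : q < g.D := by omega
    refine ⟨?_, ?_⟩
    · -- the test: a clause starts with a bracket
      have h1 : g.str = (pre ++ (cls.take q).flatMap sClause) ++ Γ'.bra ::
          ((cls[q]'(by omega)).flatMap sLit ++ Γ'.ket :: ((cls.drop (q + 1)).flatMap sClause ++ Γ'.blank :: rest)) := by
        rw [hsplit q hq]; simp [sClause]
      have := g.str_getElem?_prefix _ _ _ h1
      simp only [List.length_append] at this
      simp only [Operand.read, h52', braFlag, this, if_true]; decide
    · -- the body: one clause
      refine (g.clauseP_spec hK (hsplit q hq) hG hlt hqD hi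
        (hvars _ (List.getElem_mem _)) (hkw _ (List.getElem_mem _)) hR' hP' (by simpa using hAt')
        (by simpa using hD')).mono (fun m'' hI'' => ?_) le_rfl
      obtain ⟨hR'', hP'', hAt'', h52'', hD''⟩ := hI''
      have htake : cls.take (q + 1) = cls.take q ++ [cls[q]'(by omega)] := List.take_succ_eq_append_getElem hq
      have hlen : pre.length + ((cls.take (q + 1)).flatMap sClause).length =
          (pre ++ (cls.take q).flatMap sClause).length + (sClause (cls[q]'(by omega))).length := by
        rw [htake]
        simp only [List.flatMap_append, List.flatMap_cons, List.flatMap_nil, List.append_nil, List.length_append]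
        omega
      refine ⟨hR'', hP'', by rw [hlen]; exact hAt'', by rw [hlen]; exact h52'', fun a ha => ?_⟩
      rw [hD'' a ha, htake]
  · -- the exit: after the last clause comes the blank
    rintro m' ⟨hR', hP', hAt', h52', hD'⟩
    have h1 : g.str = (pre ++ (cls.take cls.length).flatMap sClause) ++ Γ'.blank :: rest := by
      rw [List.take_length, hstr]
    have := g.str_getElem?_prefix _ _ _ h1
    simp only [List.length_append] at this
    simp only [Operand.read, h52', braFlag, this]; decide

/-- Formula registers: formula index and row bases. [folklore] -/
def FRegs (i : ℕ) (m : ℕ → ℕ) : Prop :=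
  m 42 = i ∧ m 44 = g.Abase + i * g.H * g.d ∧ m 45 = g.Bbase + i * g.H * g.d

/-- The length of a formula on the tape. [folklore] -/
theorem length_sFormula (f : ℕ × CNF ℕ) : (sFormula f).length = f.1.bits.length + 1 + (f.2.flatMap sClause).length := by
  simp [sFormula, sBits]; omega

set_option linter.unusedSimpArgs false in
/-- **One formula.** [folklore] -/
theorem formulaP_spec (hK : g.OK W) {L : List (CNF ℕ)} {f : ℕ × CNF ℕ} {pre rest : List Γ'}
    (hstr : g.str = pre ++ sFormula f ++ Γ'.blank :: rest) {i : ℕ} (hL : L.length = i)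
    (hi : i * g.H + g.H ≤ g.N) (hf1 : f.1 ≤ g.n) (hfD : f.2.length ≤ g.D)
    (hvars : ∀ C ∈ f.2, ∀ l ∈ C, l.1 < g.n) {kw : ℕ} (hkw : ∀ C ∈ f.2, C.length ≤ kw) {m : ℕ → ℕ}
    (hR : g.BRegs m) (hF : g.FRegs i m) (hAt : g.At m pre.length)
    (hD : ∀ a, 100 ≤ a → m a = g.bheap L L a) :
    Achieves W O g.formulaP m (fun m' => g.BRegs m' ∧ g.FRegs (i + 1) m' ∧
      g.At m' (pre.length + (sFormula f).length + 1) ∧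
      ∀ a, 100 ≤ a → m' a = g.bheap (L ++ [f.2]) (L ++ [f.2]) a) (g.TformulaK kw) := by
  obtain ⟨hBv, hA, hB, hE, hNd, hHd, -, hEXe, hQ, hbot, htop, hEX, hd, h1W, hNNd, hdNd, hRW⟩ := g.facts hK
  have hH : 0 < g.H := by rw [hK.H_eq]; exact Nat.two_pow_pos _
  have hnb := hK.n_bound
  have htape : ∀ (A B : List (CNF ℕ)) s, s ≤ g.len → g.bheap A B (g.addr s) = g.tape s := fun A B s hs => by
    rw [g.bheap_of_not_region _ _ (Or.inr (g.addr_bounds hK s).1)]; exact hK.base_tape s hs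
  have hsF := length_sFormula f
  have hs1 : g.str = pre ++ f.1.bits.map Γ'.bit ++ (Γ'.comma :: (f.2.flatMap sClause ++ Γ'.blank :: rest)) := by
    rw [hstr]; simp [sFormula, sBits]
  have hsC : g.str = (pre ++ sBits f.1) ++ Γ'.comma :: (f.2.flatMap sClause ++ Γ'.blank :: rest) := by
    rw [hstr]; simp [sFormula]
  have hsCl : g.str = (pre ++ sBits f.1 ++ [Γ'.comma]) ++ f.2.flatMap sClause ++ Γ'.blank :: rest := by
    rw [hstr]; simp [sFormula]
  have hsB : g.str = (pre ++ sFormula f) ++ Γ'.blank :: rest := by rw [hstr]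
  have hlenC : pre.length + f.1.bits.length < g.len := by unfold len; rw [hsC]; simp [sBits]
  have hlenB : pre.length + (sFormula f).length < g.len := by unfold len; rw [hsB]; simp
  have hrow1 : i * g.H * g.d + g.H * g.d ≤ g.N * g.d := by rw [← Nat.add_mul]; exact Nat.mul_le_mul_right _ hi
  have hHW : g.H < 2 ^ W := by have : g.H ≤ g.H * g.d := Nat.le_mul_of_pos_right _ hd; omega
  have hbits : f.1.bits.length ≤ Nat.size g.n := bits_length_le hf1
  have hpow : 0 + 1 * 2 ^ f.1.bits.length < 2 ^ W := by
    rw [Nat.zero_add, Nat.one_mul, Nat.size_eq_bits_len]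
    have := two_pow_size_le f.1; omega
  obtain ⟨f42, f44, f45⟩ := hF
  obtain ⟨h40, h41⟩ := hAt
  unfold formulaP TformulaK
  -- 1. the guard clear
  refine Achieves.seqs_cons (R := fun m₁ => m₁ 50 = g.H ∧ m₁ 51 = g.Abase + i * g.H * g.d + g.EX ∧ m₁ 26 = g.d ∧
      (∀ i, i < 100 → i ≠ 50 → i ≠ 51 → m₁ i = m i) ∧ ∀ a, 100 ≤ a → m₁ a = g.bheap L L a) (T₁ := 2) ?_ ?_
  · refine achieves_block_of_eq (fun m₁ hm₁ => ?_) le_rfl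
    simp (disch := omega) only [execOps_cons, execOps_nil, execOp, Operand.write, Operand.read,
      merge_apply_of_lt, update_merge_of_lt, Function.update_self, Function.update_of_ne, f44, hR.r39, hR.r22,
      BinOp.eval_add_of_lt, Nat.add_zero] at hm₁
    subst hm₁
    refine ⟨?_, ?_, ?_, fun i hi a b => ?_, fun a ha => ?_⟩
    · simp (disch := omega) only [merge_apply_of_lt, Function.update_self, Function.update_of_ne]
    · simp (disch := omega) only [merge_apply_of_lt, Function.update_self, Function.update_of_ne]
    · simp (disch := omega) only [merge_apply_of_lt, Function.update_self, Function.update_of_ne, hR.r26]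
    · rw [merge_apply_of_lt hi]; simp (disch := omega) only [Function.update_of_ne]
    · rw [merge_apply_of_le ha, hD a ha]
  intro m₁ ⟨h50, h51, h26, hfr₁, hD₁⟩
  refine Achieves.seqs_cons ((fillStride_spec (v := 0) h50 h51 h26 (by omega) (by omega) hHW).mono
    (fun m₂ h => h) le_rfl) fun m₂ ⟨_, _, hfr₂, hD₂⟩ => ?_
  have hD₂' : ∀ a, 100 ≤ a → m₂ a = g.bheap (L ++ [[]]) (L ++ [[]]) a := fun a ha => by
    rw [hD₂ a ha, strideSet_congr_data (by omega) hD₁ _ _ ha, g.bheap_exClear hK L hL hi a ha]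
  have hfr₂' : ∀ i, i < 100 → i ≠ 50 → i ≠ 51 → m₂ i = m i := fun i hi a b => by rw [hfr₂ i hi a b, hfr₁ i hi a b]
  have hR₂ : g.BRegs m₂ := hR.of_frame fun i h1 h2 => hfr₂' i (by omega) (by omega) (by omega)
  -- 2. `j := 0`, the accumulator, the digit test
  refine Achieves.seqs_cons (R := fun m₃ => m₃ 43 = 0 ∧ g.BitsInv m₃ pre.length 0 1 f.1.bits 0 m₃ ∧
      (∀ i, i < 100 → i ≠ 43 → i ≠ 47 → i ≠ 48 → i ≠ 49 → i ≠ 50 → i ≠ 51 → i ≠ 52 → m₃ i = m i) ∧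
      ∀ a, 100 ≤ a → m₃ a = g.bheap (L ++ [[]]) (L ++ [[]]) a) (T₁ := 6) ?_ ?_
  · refine achieves_block_of_eq (fun m₃ hm₃ => ?_)
      (by simp only [isBitOps, List.length_cons, List.length_nil, List.length_append]; omega)
    have q40 : m₂ 40 = g.addr pre.length := by rw [hfr₂' 40 (by omega) (by omega) (by omega), h40]
    have q41 : m₂ 41 = g.tape pre.length := by rw [hfr₂' 41 (by omega) (by omega) (by omega), h41]
    rw [execOps_append] at hm₃
    simp (disch := omega) only [execOps_cons, execOps_nil, execOp, Operand.write, Operand.read,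
      merge_apply_of_lt, update_merge_of_lt, Function.update_self, Function.update_of_ne,
      BinOp.eval_band, Nat.and_self, BinOp.eval_add_of_lt (show 1 + 0 < 2 ^ W by omega)] at hm₃
    obtain ⟨v52, h52⟩ := g.execOps_isBitOps hK m₂ (s := pre.length)
      (R := Function.update (Function.update (Function.update m₂ 43 0) 47 0) 48 1) (by simp [q41])
    rw [h52] at hm₃
    subst hm₃
    refine ⟨?_, ⟨⟨?_, ?_⟩, ?_, ?_, ?_, fun i _ _ _ _ _ _ _ => rfl, fun a _ => rfl⟩,
      fun i hi a b c d' e f' k => ?_, fun a ha => ?_⟩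
    · simp (disch := omega) only [merge_apply_of_lt, Function.update_self, Function.update_of_ne]
    · simp (disch := omega) only [merge_apply_of_lt, Function.update_self, Function.update_of_ne, q40, Nat.add_zero]
    · simp (disch := omega) only [merge_apply_of_lt, Function.update_self, Function.update_of_ne, q41, Nat.add_zero]
    · simp (disch := omega) only [merge_apply_of_lt, Function.update_self, Function.update_of_ne, Nat.add_zero]
    · simp (disch := omega) only [merge_apply_of_lt, Function.update_self, Function.update_of_ne, pv, Nat.mul_zero]
    · simp (disch := omega) only [merge_apply_of_lt, Function.update_self, Function.update_of_ne, Nat.pow_zero,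
        Nat.mul_one]
    · rw [merge_apply_of_lt hi]; simp (disch := omega) only [Function.update_of_ne]; exact hfr₂' i hi e f'
    · rw [merge_apply_of_le ha, hD₂' a ha]
  intro m₃ ⟨h43, hI₃, hfr₃, hD₃⟩
  -- 3. the digits of the variable number
  refine Achieves.seqs_cons ((g.bitsLoop_spec hK (pre := pre) (rest := Γ'.comma :: (f.2.flatMap sClause ++ Γ'.blank :: rest))
      hs1 (fun b rest' h => by cases h) hpow (fun s hs => by rw [hD₃ _ (g.addr_bounds hK s).2.1, htape _ _ s hs]) hI₃).mono
      (fun _ h => h) (by have := Nat.mul_le_mul_right (9 + 2) hbits; omega))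
    fun m₄ ⟨hAt₄, _, _, _, hfr₄, hD₄⟩ => ?_
  have cfr : ∀ i, i < 100 → i ≠ 40 → i ≠ 41 → i ≠ 43 → i ≠ 47 → i ≠ 48 → i ≠ 49 → i ≠ 50 → i ≠ 51 → i ≠ 52 →
      m₄ i = m i := fun i hi a b c d' e f' k1 k2 k3 => by
    rw [hfr₄ i hi a b d' e f' k3, hfr₃ i hi c d' e f' k1 k2 k3]
  have c43 : m₄ 43 = 0 := by rw [hfr₄ 43 (by omega) (by omega) (by omega) (by omega) (by omega) (by omega) (by omega), h43]
  have cD : ∀ a, 100 ≤ a → m₄ a = g.bheap (L ++ [[]]) (L ++ [[]]) a := fun a ha => by rw [hD₄ a ha, hD₃ a ha]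
  -- 4. the comma, the clause test
  refine Achieves.seqs_cons (R := fun m₅ => g.BRegs m₅ ∧ g.PRegs i 0 m₅ ∧
      g.At m₅ (pre.length + f.1.bits.length + 1) ∧ m₅ 52 = g.braFlag (pre.length + f.1.bits.length + 1) ∧
      ∀ a, 100 ≤ a → m₅ a = g.bheap (L ++ [[]]) (L ++ [[]]) a) (T₁ := 3) ?_ ?_
  · refine achieves_block_of_eq (fun m₅ hm₅ => ?_) (by simp only [advOps, List.length_cons, List.length_nil, List.length_append]; omega)
    obtain ⟨h40₄, h41₄⟩ := hAt₄
    rw [execOps_append, g.execOps_advOps hK (s := pre.length + f.1.bits.length) hlenC (by rw [h40₄])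
      (by rw [cD _ (g.addr_bounds hK _).2.1, htape _ _ _ (by omega)])] at hm₅
    · simp (disch := omega) only [execOps_cons, execOps_nil, execOp, Operand.write, Operand.read,
        merge_apply_of_lt, update_merge_of_lt, Function.update_self, Function.update_of_ne, BinOp.eval_eq] at hm₅
      subst hm₅
      have hfr : ∀ i, i < 100 → i ≠ 40 → i ≠ 41 → i ≠ 52 →
          merge (Function.update (Function.update (Function.update m₄ 40 (g.addr (pre.length + f.1.bits.length + 1))) 41
            (g.tape (pre.length + f.1.bits.length + 1))) 52
            (if g.tape (pre.length + f.1.bits.length + 1) = g.cd Γ'.bra then 1 else 0)) m₄ i = m₄ i :=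
        fun i hi a b c => by rw [merge_apply_of_lt hi]; simp (disch := omega) only [Function.update_of_ne]
      refine ⟨hR.of_frame fun i h1 h2 => by
          rw [hfr i (by omega) (by omega) (by omega) (by omega)]
          exact cfr i (by omega) (by omega) (by omega) (by omega) (by omega) (by omega) (by omega) (by omega) (by omega) (by omega),
        ⟨?_, ?_, ?_, ?_⟩, ⟨?_, ?_⟩, ?_, fun a ha => ?_⟩
      · rw [hfr 42 (by omega) (by omega) (by omega) (by omega), cfr 42 (by omega) (by omega) (by omega) (by omega)
          (by omega) (by omega) (by omega) (by omega) (by omega) (by omega), f42]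
      · rw [hfr 43 (by omega) (by omega) (by omega) (by omega), c43]
      · rw [hfr 44 (by omega) (by omega) (by omega) (by omega), cfr 44 (by omega) (by omega) (by omega) (by omega)
          (by omega) (by omega) (by omega) (by omega) (by omega) (by omega), f44]
      · rw [hfr 45 (by omega) (by omega) (by omega) (by omega), cfr 45 (by omega) (by omega) (by omega) (by omega)
          (by omega) (by omega) (by omega) (by omega) (by omega) (by omega), f45]
      · simp (disch := omega) only [merge_apply_of_lt, Function.update_self, Function.update_of_ne]
      · simp (disch := omega) only [merge_apply_of_lt, Function.update_self, Function.update_of_ne]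
      · simp (disch := omega) only [merge_apply_of_lt, Function.update_self, Function.update_of_ne]
        simp only [braFlag, g.tape_eq_code_iff hK]
      · rw [merge_apply_of_le ha, cD a ha]
  intro m₅ ⟨hR₅, hP₅, hAt₅, h52₅, hD₅⟩
  -- 5. the clauses
  refine Achieves.seqs_cons (g.clauseLoop_spec hK (pre := pre ++ sBits f.1 ++ [Γ'.comma]) (rest := rest) hsCl hL hfD hi
    hvars hkw hR₅ hP₅ (by simpa [sBits, Nat.add_assoc] using hAt₅) (by simpa [sBits, Nat.add_assoc] using h52₅) hD₅)
    fun m₆ ⟨hR₆, hP₆, hAt₆, hD₆⟩ => ?_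
  -- 6. the blank, `i += 1`, the row bases
  refine Achieves.seqs_cons (T₂ := 0) ?_ fun m₇ h => Achieves.seqs_nil h
  refine achieves_block_of_eq (fun m₇ hm₇ => ?_) (by simp only [advOps, List.length_cons, List.length_nil, List.length_append]; omega)
  obtain ⟨h40₆, h41₆⟩ := hAt₆
  obtain ⟨q42, _, q44, q45⟩ := hP₆
  have hiN : i + 1 ≤ g.N := by have := Nat.le_mul_of_pos_right i hH; omega
  have hposF : (pre ++ sBits f.1 ++ [Γ'.comma]).length + (f.2.flatMap sClause).length = pre.length + (sFormula f).length := by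
    rw [hsF]; simp [sBits]; omega
  rw [hposF] at h40₆ h41₆
  rw [execOps_append, g.execOps_advOps hK (s := pre.length + (sFormula f).length) hlenB (by rw [h40₆])
    (by rw [hD₆ _ (g.addr_bounds hK _).2.1, htape _ _ _ (by omega)])] at hm₇
  · simp (disch := omega) only [execOps_cons, execOps_nil, execOp, Operand.write, Operand.read,
      merge_apply_of_lt, update_merge_of_lt, Function.update_self, Function.update_of_ne, q42, q44, q45, hR₆.r36,
      BinOp.eval_add_of_lt] at hm₇
    subst hm₇
    have hfr : ∀ rg, rg < 100 → rg ≠ 40 → rg ≠ 41 → rg ≠ 42 → rg ≠ 44 → rg ≠ 45 →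
        merge (Function.update (Function.update (Function.update (Function.update (Function.update m₆ 40
          (g.addr (pre.length + (sFormula f).length + 1))) 41 (g.tape (pre.length + (sFormula f).length + 1))) 42
          (i + 1)) 44 (g.Abase + i * g.H * g.d + g.Hd)) 45 (g.Bbase + i * g.H * g.d + g.Hd)) m₆ rg = m₆ rg :=
      fun rg hi a b c d' e => by rw [merge_apply_of_lt hi]; simp (disch := omega) only [Function.update_of_ne]
    have hrow : g.Abase + i * g.H * g.d + g.Hd = g.Abase + (i + 1) * g.H * g.d ∧
        g.Bbase + i * g.H * g.d + g.Hd = g.Bbase + (i + 1) * g.H * g.d := by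
      rw [hHd, Nat.succ_mul, Nat.add_mul]; omega
    refine ⟨hR₆.of_frame fun rg h1 h2 => hfr rg (by omega) (by omega) (by omega) (by omega) (by omega) (by omega),
      ⟨?_, ?_, ?_⟩, ⟨?_, ?_⟩, fun a ha => ?_⟩
    · simp (disch := omega) only [merge_apply_of_lt, Function.update_self, Function.update_of_ne]
    · simp (disch := omega) only [merge_apply_of_lt, Function.update_self, Function.update_of_ne, hrow.1]
    · simp (disch := omega) only [merge_apply_of_lt, Function.update_self, Function.update_of_ne, hrow.2]
    · simp (disch := omega) only [merge_apply_of_lt, Function.update_self, Function.update_of_ne]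
    · simp (disch := omega) only [merge_apply_of_lt, Function.update_self, Function.update_of_ne]
    · rw [merge_apply_of_le ha, hD₆ a ha]

/-- Splitting the tape at formula `q`. [folklore] -/
theorem sAll_split (Fs : List (ℕ × CNF ℕ)) {q : ℕ} (hq : q < Fs.length) :
    sAll Fs = sAll (Fs.take q) ++ sFormula (Fs[q]) ++ Γ'.blank :: sAll (Fs.drop (q + 1)) := by
  have hF : Fs = Fs.take q ++ Fs[q] :: Fs.drop (q + 1) := by
    conv_lhs => rw [← List.take_append_drop q Fs, List.drop_eq_getElem_cons hq]
  unfold sAll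
  conv_lhs => rw [hF]
  rw [List.flatMap_append, List.flatMap_cons]; simp only [List.append_assoc, List.cons_append, List.nil_append]

set_option linter.unusedSimpArgs false in
/-- **The parser.** If the tape holds `sAll Fs` (variable numbers `≤ n`, at most `D` clauses per
formula, variables `< n`, widths `≤ kw`, and `|Fs| · H ≤ N` rows available), then from the constant
registers and the intended memory of the empty disjunction the parser reaches the intended memory of
`F = Fs.map Prod.snd`, within `Tparse kw |Fs|` steps. [folklore] -/
theorem parsePhase_spec (hK : g.OK W) {Fs : List (ℕ × CNF ℕ)} (hstr : g.str = sAll Fs)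
    (hf1 : ∀ f ∈ Fs, f.1 ≤ g.n) (hfD : ∀ f ∈ Fs, f.2.length ≤ g.D)
    (hvars : ∀ f ∈ Fs, ∀ C ∈ f.2, ∀ l ∈ C, l.1 < g.n) {kw : ℕ} (hkw : ∀ f ∈ Fs, ∀ C ∈ f.2, C.length ≤ kw)
    (hrows : Fs.length * g.H ≤ g.N) {m : ℕ → ℕ} (hR : g.BRegs m)
    (hD : ∀ a, 100 ≤ a → m a = g.bheap [] [] a) :
    Achieves W O g.parsePhase m (fun m' => g.BRegs m' ∧
      ∀ a, 100 ≤ a → m' a = g.bheap (Fs.map Prod.snd) (Fs.map Prod.snd) a) (g.Tparse kw Fs.length) := by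
  obtain ⟨hBv, hA, hB, hE, hNd, hHd, -, hEXe, hQ, hbot, htop, hEX, hd, h1W, hNNd, hdNd, hRW⟩ := g.facts hK
  have htape : ∀ (A B : List (CNF ℕ)) s, s ≤ g.len → g.bheap A B (g.addr s) = g.tape s := fun A B s hs => by
    rw [g.bheap_of_not_region _ _ (Or.inr (g.addr_bounds hK s).1)]; exact hK.base_tape s hs
  have hi₁ := hK.i₁_lt
  set F := Fs.map Prod.snd with hFdef
  unfold parsePhase Tparse
  refine Achieves.seqs_cons (R := fun m₁ => g.BRegs m₁ ∧ g.FRegs 0 m₁ ∧ g.At m₁ 0 ∧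
      ∀ a, 100 ≤ a → m₁ a = g.bheap [] [] a) (T₁ := 6) ?_ ?_
  · refine achieves_block_of_eq (fun m₁ hm₁ => ?_) le_rfl
    have hptr : g.bheap [] [] (g.Qtm + g.i₁) = g.addr 0 := by
      rw [g.bheap_of_not_region _ _ (Or.inr (by omega))]; exact hK.base_ptr
    have htp0 : g.bheap [] [] (g.addr 0) = g.tape 0 := htape _ _ 0 (Nat.zero_le _)
    obtain ⟨-, h100, hW0⟩ := g.addr_bounds hK 0
    unfold parseInitOps at hm₁
    simp (disch := omega) only [execOps_cons, execOps_nil, execOp, Operand.write, Operand.read,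
      merge_apply_of_lt, merge_apply_of_le, update_merge_of_lt, Function.update_self, Function.update_of_ne,
      hR.r38, hR.r34, hR.r35, BinOp.eval_add_of_lt, BinOp.eval_band, Nat.and_self, Nat.add_zero, hD _ (by omega : 100 ≤ g.Qtm + g.i₁),
      hptr, hD _ h100, htp0] at hm₁
    subst hm₁
    refine ⟨hR.of_frame fun i h1 h2 => by rw [merge_apply_of_lt (by omega)]; simp (disch := omega) only [Function.update_of_ne],
      ⟨?_, ?_, ?_⟩, ⟨?_, ?_⟩, fun a ha => ?_⟩
    · simp (disch := omega) only [merge_apply_of_lt, Function.update_self, Function.update_of_ne]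
    · simp (disch := omega) only [merge_apply_of_lt, Function.update_self, Function.update_of_ne, Nat.zero_mul, Nat.add_zero]
    · simp (disch := omega) only [merge_apply_of_lt, Function.update_self, Function.update_of_ne, Nat.zero_mul, Nat.add_zero]
    · simp (disch := omega) only [merge_apply_of_lt, Function.update_self, Function.update_of_ne]
    · simp (disch := omega) only [merge_apply_of_lt, Function.update_self, Function.update_of_ne]
    · rw [merge_apply_of_le ha, hD a ha]
  intro m₁ ⟨hR₁, hF₁, hAt₁, hD₁⟩
  refine Achieves.seqs_cons (T₂ := 0) ?_ fun m' h => Achieves.seqs_nil h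
  refine Achieves.whilenz Fs.length (g.TformulaK kw)
    (fun q m' => g.BRegs m' ∧ g.FRegs q m' ∧ g.At m' (sAll (Fs.take q)).length ∧
      ∀ a, 100 ≤ a → m' a = g.bheap (F.take q) (F.take q) a)
    ?_ ?_ ⟨hR₁, hF₁, by simpa [sAll] using hAt₁, by simpa using hD₁⟩ ?_ le_rfl
  rotate_left 2
  · rintro m' ⟨hR', _, _, hD'⟩
    have hfull : F.take Fs.length = F := List.take_of_length_le (by rw [hFdef, List.length_map])
    rw [hfull] at hD'
    exact ⟨hR', hD'⟩
  · intro q hq m' hI'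
    obtain ⟨hR', hF', hAt', hD'⟩ := hI'
    refine ⟨?_, ?_⟩
    · -- the test: inside the string the symbol code is positive
      have hlt : (sAll (Fs.take q)).length < g.len := by
        unfold len; rw [hstr, sAll_split Fs hq]; simp
      obtain ⟨-, h41'⟩ := hAt'
      simp only [Operand.read, h41', tape, dif_pos hlt]
      exact (hK.cd_pos _).ne'
    -- the body: one formula
    have hsp : g.str = sAll (Fs.take q) ++ sFormula (Fs[q]) ++ Γ'.blank :: sAll (Fs.drop (q + 1)) := by rw [hstr, sAll_split Fs hq]
    have hmem : Fs[q] ∈ Fs := List.getElem_mem _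
    have hrow : q * g.H + g.H ≤ g.N := by
      have : (q + 1) * g.H ≤ Fs.length * g.H := Nat.mul_le_mul_right _ hq
      rw [Nat.succ_mul] at this; omega
    refine (g.formulaP_spec hK hsp (by rw [hFdef, List.length_take, List.length_map]; omega) hrow (hf1 _ hmem)
      (hfD _ hmem) (hvars _ hmem) (hkw _ hmem) hR' hF' hAt' hD').mono (fun m'' hI'' => ?_) le_rfl
    obtain ⟨hR'', hF'', hAt'', hD''⟩ := hI''
    have htake : F.take (q + 1) = F.take q ++ [(Fs[q]).2] := by
      rw [hFdef, List.take_succ_eq_append_getElem (by simpa using hq)]; simp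
    have hlen : (sAll (Fs.take (q + 1))).length = (sAll (Fs.take q)).length + (sFormula Fs[q]).length + 1 := by
      rw [List.take_succ_eq_append_getElem hq]
      unfold sAll
      rw [List.flatMap_append, List.flatMap_cons, List.flatMap_nil, List.append_nil, List.length_append,
        List.length_append, List.length_singleton]
      omega
    refine ⟨hR'', hF'', by rw [hlen]; exact hAt'', fun a ha => by rw [hD'' a ha, htake]⟩
  · -- the exit: the bottom of the stack reads `0`
    rintro m' ⟨hR', hF', hAt', hD'⟩
    obtain ⟨-, h41'⟩ := hAt'
    have : (sAll (Fs.take Fs.length)).length = g.len := by rw [List.take_length]; unfold len; rw [hstr]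
    simp only [Operand.read, h41', this, tape, lt_irrefl, dif_neg, not_false_eq_true]

end loopSpecs

end BP

end Literature.Computability.FineGrained.OVRed
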